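import Summits.ValiantsHypothesis.ValiantsHypothesis.Theses.DivisionGap
import Literature.Barriers.ValiantsHypothesis.MonotoneGapProofs
import Literature.Barriers.ValiantsHypothesis.MonotoneGapUpper
import Literature.Computability.AlgebraicComplexity.BurgisserBooleanPartsA3Steps
import Literature.Computability.AlgebraicComplexity.ArithCircuitProofs
import Literature.Computability.AlgebraicComplexity.ValiantClassesProofs
import Summits.ValiantsHypothesis.ValiantsHypothesis.Theorems.ZeroOneTransfer.Negative.LowDegreeCofactor

/-!
# Disproof of `ZeroOneTransfer` (crux `stmt-ValiantsHypothesis-5066`, route DivisionGap) — findings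

Standing-adversary work file (refuter, cdisprove mode).  Prose lives in docstrings only.

The crux (H2 of the card): every p-family `f_n ∈ ℝ≥0[σ_n]` with coefficients in `{0,1}` whose
complexification is in `VP_ℂ` has quasi-polynomially bounded *division complexity*
`min_{h ≠ 0} L₊(f_n · h) + L₊(h)` (`L₊` = the tree's fan-in-two `complexity` over the semiring
`ℝ≥0`).

## Findings (all `sorry`-free unless marked)

* `divComplexity`, `zeroOneTransfer_iff` — the crux restated as
  `IsQPBounded (divComplexity ∘ f)`; `divComplexity_le_complexity` (`h := 1`): the crux is
  implied by plain quasi-polynomial MONOTONE complexity, so only division-robust lower bounds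
  can kill it.
* (A) LOAD-BEARING `IsVPFamily`: `zeroOneTransfer_false_without_VP` — dropping the `VP_ℂ`
  hypothesis (even keeping one variable) the statement is false: `f_n = X ^ 2 ^ 2 ^ ((2n)^n + 1)`
  has `0/1` coefficients and `deg (f_n h) ≥ deg f_n` forces `L₊(f_n h) ≥ log₂ deg` by the degree
  bound `deg ≤ 2 ^ size` (`totalDegree_eval_le_two_pow_size`).  Any proof must use (at least the
  degree clause of) `IsVPFamily`.
* (B) LOAD-BEARING division (the factor `h`): the natural strengthening with `h := 1`,
  `ZeroOneTransferNoDivision` ("every 0/1 `VP_ℂ` family has quasi-polynomial monotone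
  complexity"), is FALSE: `not_zeroOneTransferNoDivision`, witnessed by Jerrum–Snir's spanning
  tree polynomial `stPoly` (0/1 coefficients `coeff_stPoly`, `VP` by `isVPFamily_stPoly_holds`,
  monotone complexity `≥ 2^{N/20}` for `N ≥ 60` — `complexity_stPoly_ge`, the tree's
  `JerrumSnir1982_spanningTree_holds` re-run for WEIGHTED fan-in-two circuits, i.e. for the
  tree's `complexity` over `ℝ≥0`, which the barrier file leaves unstated).  So a refutation of
  the crux needs a lower bound that survives an arbitrary nonzero cofactor `h`; by
  FominGrigorievKoshevoy2014 Thm 7.2 this very witness collapses with division (support item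
  `StDivisionEasy`).
* (B2) LOW-DEGREE COFACTORS DO NOT HELP (landing as `Theorems/ZeroOneTransfer/Negative/`
  `TopComponentFree.lean` p74859, `KillRows.lean` p74865, `LowDegreeCofactor.lean` to follow;
  all sorry-free, checked together in the disprover's folder `neg/Scratch2.lean`):
  (i) INITIAL FORMS ARE FREE — for every weight `w : σ → ℕ`,
  `complexity (topComponent w p) ≤ complexity p` over `ℝ≥0` (gate-by-gate pruning; no
  cancellation); (ii) for every nonzero `h` with `deg h + 60 ≤ N`,
  `2^{(N - deg h)/20} ≤ complexity (ST_N * h) + 1` — the row-lexicographic top component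
  concentrates `h` on `≤ deg h` rows, the projection `killRows` (those rows `↦ 1`, pointers into
  them `↦ 0`) turns it into a nonzero constant and `ST_N` into a polynomial with the support of
  `ST_{N-δ'}`, and Jerrum–Snir is support-only; (iii) hence the natural strengthening
  "cofactor of degree `≤ deg(f_n)/2`" of the crux is FALSE (`zeroOneTransfer_lowDegreeCofactor_false`,
  witness `ST`).  Consequence for provers: any positivity normal form `f·h = g` proving the crux
  must produce denominators of degree comparable to `deg f` (for `ST_N`: `> N - O((log N)^c)`),
  as FGK's star–mesh certificate does; the same two steps give `L(per_{n-δ}) ≲ L(per_n · h)` for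
  `deg h ≤ δ` (H1's low-degree rung, modulo the weighted form of JS §4.3 — not yet in the tree).
* (B2') THE SAME TWO MOVES PROVE H1's LOW-DEGREE RUNG (filed for `PerDivisionHard`, 5065, as
  `Theorems/PerDivisionHard/Negative/{PerSupportBound,PerLowDegreeRung}.lean`; sorry-free, std
  axioms, combined check `neg/Scratch3.lean`): `two_pow_le_complexity_perPoly_mul` — for every
  nonzero `h` with `deg h + 6 ≤ n`, `2^{(n - deg h)/3} ≤ complexity (per_n * h) + 1` (Jerrum–Snir
  by support for `per` in the WEIGHTED model, `2^{m/3}` via central binomials; `perKill`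
  projection; initial forms free).  So `PerMultiplesHard`/`PerDivisionHard` hold for all
  cofactors of degree `≤ n - 3(log₂ n + c)^c - 3`: what is open in H1 is exactly the regime
  `deg h > n - O(polylog n)`, and symmetrically what could still make H2 true is only
  certificates with such high-degree denominators.
* (C) KILL CRITERION made formal: `zeroOneTransfer_false_of_triangularDimers_hard` —
  Kasteleyn (`D_n ∈ VP_ℂ`, hypothesis) + `¬ TriangularDimersDivisionEasy` ⇒ `¬ ZeroOneTransfer`
  (`coeff_sum_prod_X_graph`: graph/dimer sums have 0/1 coefficients).  Crux-4 probe (kit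
  j008644): on `T_4`, `T_6` every non-degenerate 4-point plane condensation has a nonzero
  same-side companion term, i.e. needs a subtraction.
* (D) DIVISION-EASINESS DESCENDS TO EVERY FACE AND EVERY POSITIVE SPECIALISATION (cycle 2;
  landing as `Theorems/ZeroOneTransfer/Negative/Faces.lean`): `divComplexity_topComponent_le`
  (`divC (top_w f) ≤ divC f` — initial forms are free for division complexity, lemma B2 of card
  free-degeneration, from the landed `Negative.complexity_topComponent_le`),
  `divComplexity_aeval_le_of_pos` (positive substitutions with NONZERO constants, lemma A1 of
  card arborescence-span), `divComplexity_le_rename`.  KILL CRITERION (D)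
  `zeroOneTransfer_false_of_hard_face`: one 0/1 `VP_ℂ` family with ONE super-qp division-hard
  face refutes the crux (the crux implies the card's `FaceClosure`,
  `isQPBounded_divComplexity_face_of_zeroOneTransfer`).  ROUTE CONSISTENCY
  `not_perDivisionHard_and_zeroOneTransfer_of_perFace`: if `per_{m n}` (`m n ≥ n`) is, up to
  renaming, a face polynomial of some 0/1 `VP_ℂ` family then H1 ∧ H2 fails — so the route
  silently asserts "per is not an initial form of any 0/1 `VP` family".  OBSTRUCTION recorded in
  `resists` (v): initial forms of `VP` families lie in the border class `VP‾`
  (`in_w f = lim_t t^{-D} f(t^w x)`), so a `VNP`-hard face would prove `VNP ⊆ VP‾`, the negation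
  of the Mulmuley–Sohoni conjecture; the face route can only kill the crux through a face with a
  DIRECT division lower bound, and none is known.
* (E) COFACTORS ON FEW ROWS / PÓLYA MULTIPLIERS OF ANY DEGREE NEVER HELP (cycle 2; landing as
  `Theorems/ZeroOneTransfer/Negative/Polya.lean`): `two_rpow_le_complexity_stPoly_mul_of_rows`
  (`2^{(N-|R|)/20} ≤ L(ST_N · h) + 1` whenever the row-lex initial form of `h ≠ 0` lives on rows
  `R`, `|R| + 60 ≤ N` — degree of `h` arbitrary), `rows_topComponent_linPow` (the initial form of
  `(a + Σ x)^M` lives on ONE row), `two_rpow_le_complexity_stPoly_mul_linPow`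
  (`2^{(N-1)/20} ≤ L(ST_N · (a + Σ x)^M) + 1` for all `M`, `a`), and
  `zeroOneTransfer_polya_false`: the strengthening of the crux with cofactors restricted to PÓLYA
  MULTIPLIERS `(1 + Σ_i x_i)^M` (Pólya 1928; the denominators of FGK14 §8) is FALSE (witness `ST`).
  With (B2): a proof of the crux must use cofactors whose initial forms spread over all but
  `O((log N)^c)` rows — powers of a fixed linear form, low-degree `h`, and any `h` in the
  variables of `N - 60` rows are excluded.
* (G) EXCHANGE CONNECTIVITY (cycle 2; landing as `Theorems/ZeroOneTransfer/Negative/Exchange.lean` (core)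
  + `ExchangeFace.lean`, `ExchangePerDimer.lean`, `ExchangeSum.lean` (instances; ≤ 400 lines each)):
  `exists_exchange` (two distinct arborescences admit a single-node re-hanging towards each
  other), `arborescence_chain_induction`; for positive projections `ST_N(e)` (`e v ∈ {X j, C r}`)
  the support is the set of exponents of surviving arborescences and consecutive chain members
  move the exponent by ONE label (`vexp_update`); hence `not_posProj_stPoly_of_split` /
  `not_posProj_stPoly_of_isolated` (split or isolated supports are never positive
  `ST`-projections) with instances: `not_posProj_XaXb_add_XcXd` — `x_a x_b + x_c x_d` is not a
  positive projection of any `ST_N` although it is a FACE of `ST_2` (`stPoly_two`,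
  `topComponent_stPoly_two`, `face_of_stPoly_two_not_posProj`), so positive `ST`-projections are
  NOT closed under initial forms — the obstruction theory (4) of card arborescence-span ("faces
  of arborescence polytopes are arborescence polytopes of sub-digraphs") is false as stated
  (faces are laminar-tight families; a face-closed positive normal form on `ST` needs them or
  `J ≥ 2`); `perPoly_not_posProj_stPoly` — `per_n` (`n ≥ 2`) is not a positive projection of any
  `ST_N` (the trivial inconsistency of the route, `per` a positive projection of the
  division-easy `ST`, is excluded for every `N` at once); `not_posProj_stPoly_dimerSum` — no
  dimer polynomial `Σ_f Π_v x_{(v,f v)}` with two covers (cruxes 4 and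
  `SquareGridDimersDivisionEasy`) is a positive `ST`-projection: Temperley/KPW identities
  project dimers ONTO trees, not conversely; `not_posProj_stPoly_sum` — `ST_a(x) + ST_b(y)`
  (`a ≥ 2`, `b ≥ 1`) is not one either: single `ST`-quotients are not closed under sums, so the
  `J`-term form of the span is necessary (`StQuotientComplete` dies on sums).
* LITERATURE (cycle 2): HertrichLoho2024 (arXiv:2411.03006, read p.1–4): the polytope shadow of
  a division certificate `f·h = g` is a VIRTUAL EXTENDED FORMULATION `Newt f + Newt h = Newt g`
  with `xc(Newt g), xc(Newt h) = O(size)`, so `divC(f) ≳ vxc(Newt f)`; p.4: "This leaves the open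
  question to find ways to lower-bound vxc(P)" — no lower-bound technique for virtual extension
  complexity exists, and their §4.3 shows `xc(R) ≪ xc(P)` is possible for `P + Q = R` (Minkowski
  sums can collapse extension complexity — the polytope analogue of "division helps"); Hertrich
  et al. 2026: `vxc = O(n³)` for regular-matroid base polytopes (consistent with the crux).
  HertrichKoberLoho2025 (arXiv:2511.02406, read p.2 Thm 1, p.4): "For a regular matroid M with n
  elements, there is a (+,×,/)-circuit of size O(n³) computing the basis generating polynomial"
  (via Maurer's matrix-tree theorem for regular matroids + Seymour decomposition) — so the
  route's suspect class "regular / unimodular matroid basis polynomials" (why-might-fail of this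
  crux) has COLLAPSED: it supports the crux; they expect no extension much beyond regular/MFMC
  matroids (binary: counting bases is #P-hard).  Sacher 2025 (arXiv:2506.12246, "Arithmetic
  Circuits with Division") concerns McKenzie–Wagner membership problems over sets of naturals —
  unrelated.  Semantic Scholar sweep 2024–26 ("monotone arithmetic circuits"): nothing else on
  lower bounds with division; OpenAlex/S2 citation sweeps of HY21 rate-limited this session.
* WHY IT RESISTS (docstring of `resists`): no super-polynomial lower bound for monotone
  circuits WITH division is known for any explicit monotone polynomial (HrubesYehudayoff2021 §6,
  Problem 2 / Open Problem 3); an unconditional `¬ ZeroOneTransfer` would be the first such bound,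
  for a `VP` family at that.  Two reductions recorded there (tropical: `L_÷(f) ≥ ½ ·` size of
  `(min,+,−)` circuits = ReLU networks for `w ↦ min_{α ∈ supp f} ⟨α,w⟩`; Boolean:
  `[f h > 0] = [f > 0] ∧ [h > 0]`) give nothing super-quasi-polynomial for `VP` families.
-/

noncomputable section

namespace Summit.ValiantsHypothesis.ValiantsHypothesis.Cruxes.ZeroOneTransfer.Disproof

set_option linter.dupNamespace false

open Literature.Computability.AlgebraicComplexity Literature.Barriers.ValiantsHypothesis
open MvPolynomial Finset Filter
open scoped NNReal

open Summit.ValiantsHypothesis.ValiantsHypothesis.Theses.DivisionGap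
  (ZeroOneTransfer TriangularDimersDivisionEasy)

/-! ### The division complexity and a restatement of the crux -/

/-- Division complexity of `f ∈ k[σ]` in the Hrubeš–Yehudayoff monotone-multiple normal form:
the least `L(f·h) + L(h)` over nonzero cofactors `h` (over `ℝ≥0`: subtraction-free complexity
with one division, up to `O(1)`). [cite: HrubesYehudayoff2021, §6] -/
def divComplexity {k : Type*} [CommSemiring k] {σ : Type*} (f : MvPolynomial σ k) : ℕ :=
  sInf {s | ∃ h : MvPolynomial σ k, h ≠ 0 ∧ complexity (f * h) + complexity h = s}

/-- `h := 1` is admissible: division complexity is at most plain complexity. [folklore] -/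
theorem divComplexity_le_complexity {k : Type*} [CommSemiring k] [Nontrivial k] {σ : Type*}
    (f : MvPolynomial σ k) : divComplexity f ≤ complexity f := by
  have hC : complexity (C 1 : MvPolynomial σ k) ≤ 0 := by
    have := ArithCircuit.complexity_le_size (ArithCircuit.IsFanInTwo.ofConst (1 : k))
      (ArithCircuit.eval_ofConst (σ := σ) (1 : k))
    simpa using this
  have h1 : complexity (1 : MvPolynomial σ k) = 0 := by
    rw [← C_1]; exact Nat.le_zero.mp hC
  refine Nat.sInf_le ⟨1, one_ne_zero, ?_⟩
  rw [mul_one, h1, add_zero]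

/-- The defining set of `divComplexity f` is attained (it is nonempty via `h = 1`). [folklore] -/
theorem exists_eq_divComplexity {k : Type*} [CommSemiring k] [Nontrivial k] {σ : Type*}
    (f : MvPolynomial σ k) :
    ∃ h : MvPolynomial σ k, h ≠ 0 ∧ complexity (f * h) + complexity h = divComplexity f :=
  Nat.sInf_mem (⟨_, 1, one_ne_zero, rfl⟩ :
    Set.Nonempty {s | ∃ h : MvPolynomial σ k, h ≠ 0 ∧ complexity (f * h) + complexity h = s})

/-- The crux is exactly: the division complexity of every 0/1 `VP_ℂ` family is quasi-polynomially
bounded (`IsQPBounded`). [folklore] -/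
theorem zeroOneTransfer_iff :
    ZeroOneTransfer ↔
      ∀ (σ : ℕ → Type) [∀ n, Fintype (σ n)] (f : ∀ n, MvPolynomial (σ n) ℝ≥0),
        (∀ n m, coeff m (f n) = 0 ∨ coeff m (f n) = 1) →
        IsVPFamily (k := ℂ) (fun n => map (Complex.ofRealHom.comp NNReal.toRealHom) (f n)) →
        IsQPBounded fun n => divComplexity (f n) := by
  constructor
  · intro H σ _ f h01 hVP
    obtain ⟨c, hc⟩ := H σ f h01 hVP
    refine ⟨c, fun n => ?_⟩
    obtain ⟨h, hne, hle⟩ := hc n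
    exact le_trans (Nat.sInf_le (show complexity (f n * h) + complexity h ∈
      {s | ∃ h' : MvPolynomial (σ n) ℝ≥0, h' ≠ 0 ∧ complexity (f n * h') + complexity h' = s}
      from ⟨h, hne, rfl⟩)) hle
  · intro H σ _ f h01 hVP
    obtain ⟨c, hc⟩ := H σ f h01 hVP
    refine ⟨c, fun n => ?_⟩
    obtain ⟨h, hne, heq⟩ := exists_eq_divComplexity (f n)
    exact ⟨h, hne, heq ▸ hc n⟩

/-! ### (A) The `VP` hypothesis is load-bearing -/

/-- The crux with the hypothesis `IsVPFamily` dropped (0/1 coefficients kept). [folklore] -/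
def ZeroOneTransferWithoutVP : Prop :=
  ∀ (σ : ℕ → Type) [∀ n, Fintype (σ n)] (f : ∀ n, MvPolynomial (σ n) ℝ≥0),
    (∀ n m, coeff m (f n) = 0 ∨ coeff m (f n) = 1) →
    ∃ c : ℕ, ∀ n, ∃ h : MvPolynomial (σ n) ℝ≥0, h ≠ 0 ∧
      complexity (f n * h) + complexity h ≤ 2 ^ ((Nat.log 2 n + c) ^ c)

/-- Degree lower bound: `deg g ≤ 2 ^ L(g)` for every polynomial over a commutative semiring
(Bürgisser's `deg ≤ 2^{size}` at an optimal circuit). [cite: Burgisser2000TCS, Lemma 2.4 p. 77] -/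
theorem totalDegree_le_two_pow_complexity {k : Type*} [CommSemiring k] {σ : Type*}
    (g : MvPolynomial σ k) : g.totalDegree ≤ 2 ^ complexity g := by
  obtain ⟨P, h2, hP, hsize⟩ := ArithCircuit.exists_computes_size_eq_complexity g
  rw [← hsize, ← show P.eval = g from hP]
  exact totalDegree_eval_le_two_pow_size h2

/-- Multiplying by a nonzero polynomial over `ℝ≥0` does not lower the degree below that of a
monomial factor: `N ≤ deg (X i ^ N * h)` for `h ≠ 0`. [folklore] -/
theorem le_totalDegree_X_pow_mul {σ : Type*} (i : σ) (N : ℕ) {h : MvPolynomial σ ℝ≥0}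
    (hh : h ≠ 0) : N ≤ ((X i : MvPolynomial σ ℝ≥0) ^ N * h).totalDegree := by
  classical
  obtain ⟨m, hm⟩ := MvPolynomial.ne_zero_iff.mp hh
  have hcoeff : coeff (Finsupp.single i N + m) ((X i : MvPolynomial σ ℝ≥0) ^ N * h) ≠ 0 := by
    rw [X_pow_eq_monomial, coeff_monomial_mul]
    simpa using hm
  calc N ≤ (Finsupp.single i N + m).sum (fun _ e => e) := by
        rw [Finsupp.sum_add_index' (fun _ => rfl) (fun _ _ _ => rfl), Finsupp.sum_single_index rfl]
        exact Nat.le_add_right _ _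
    _ ≤ _ := le_totalDegree (mem_support_iff.mpr hcoeff)

/-- **(A) `¬ ZeroOneTransferWithoutVP`.**  Witness: one variable, `f_n = X ^ 2 ^ 2 ^ ((2n)^n + 1)`
(coefficients `0/1`).  For the `c` allegedly produced, at `n = c` every nonzero `h` gives
`deg (f_c · h) ≥ 2 ^ 2 ^ ((2c)^c + 1)`, whereas `L(f_c · h) ≤ 2 ^ ((log₂ c + c)^c) ≤ 2 ^ ((2c)^c)`
forces `deg ≤ 2 ^ 2 ^ ((2c)^c)`.  So any proof of the crux must use `IsVPFamily` (its degree
clause at least). [folklore] -/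
theorem zeroOneTransfer_false_without_VP : ¬ ZeroOneTransferWithoutVP := by
  intro H
  obtain ⟨c, hc⟩ := H (fun _ => Unit)
    (fun n => (X () : MvPolynomial Unit ℝ≥0) ^ 2 ^ 2 ^ ((2 * n) ^ n + 1))
    (by
      intro n m
      classical
      rw [X_pow_eq_monomial, coeff_monomial]
      split_ifs <;> simp)
  obtain ⟨h, hne, hle⟩ := hc c
  -- size bound ⇒ degree bound
  have hL : complexity ((X () : MvPolynomial Unit ℝ≥0) ^ 2 ^ 2 ^ ((2 * c) ^ c + 1) * h) ≤
      2 ^ ((Nat.log 2 c + c) ^ c) := (Nat.le_add_right _ _).trans hle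
  have hlog : Nat.log 2 c + c ≤ 2 * c := by
    have := Nat.log_le_self 2 c
    omega
  have hexp : (Nat.log 2 c + c) ^ c ≤ (2 * c) ^ c := Nat.pow_le_pow_left hlog c
  have hdeg := (le_totalDegree_X_pow_mul () (2 ^ 2 ^ ((2 * c) ^ c + 1)) hne).trans
    (totalDegree_le_two_pow_complexity _)
  have h1 : 2 ^ 2 ^ ((2 * c) ^ c + 1) ≤ 2 ^ 2 ^ ((2 * c) ^ c) := by
    calc 2 ^ 2 ^ ((2 * c) ^ c + 1) ≤ 2 ^ complexity _ := hdeg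
      _ ≤ 2 ^ 2 ^ ((Nat.log 2 c + c) ^ c) := Nat.pow_le_pow_right two_pos hL
      _ ≤ 2 ^ 2 ^ ((2 * c) ^ c) :=
          Nat.pow_le_pow_right two_pos (Nat.pow_le_pow_right two_pos hexp)
  have h2 : 2 ^ ((2 * c) ^ c + 1) ≤ 2 ^ ((2 * c) ^ c) :=
    (Nat.pow_le_pow_iff_right (by norm_num)).mp h1
  have h3 : (2 * c) ^ c + 1 ≤ (2 * c) ^ c := (Nat.pow_le_pow_iff_right (by norm_num)).mp h2
  omega

/-! ### (B) Division is load-bearing: the `h := 1` strengthening is false -/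

/-- The natural strengthening of the crux with the cofactor frozen to `h = 1`: every 0/1 `VP_ℂ`
family has quasi-polynomially bounded MONOTONE complexity.  (The refuted transfer class
`MonotoneLowerBoundsTransfer` of the barrier file in contrapositive, quasi-polynomial form.)
[cite: Valiant1980, §3 (Thm. 1–2)] -/
def ZeroOneTransferNoDivision : Prop :=
  ∀ (σ : ℕ → Type) [∀ n, Fintype (σ n)] (f : ∀ n, MvPolynomial (σ n) ℝ≥0),
    (∀ n m, coeff m (f n) = 0 ∨ coeff m (f n) = 1) →
    IsVPFamily (k := ℂ) (fun n => map (Complex.ofRealHom.comp NNReal.toRealHom) (f n)) →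
    ∃ c : ℕ, ∀ n, complexity (f n) ≤ 2 ^ ((Nat.log 2 n + c) ^ c)

/-- The strengthening implies the crux (take `h = 1`). [folklore] -/
theorem zeroOneTransfer_of_noDivision (H : ZeroOneTransferNoDivision) : ZeroOneTransfer := by
  intro σ _ f h01 hVP
  obtain ⟨c, hc⟩ := H σ f h01 hVP
  refine ⟨c, fun n => ⟨1, one_ne_zero, ?_⟩⟩
  have h1 : complexity (1 : MvPolynomial (σ n) ℝ≥0) = 0 := by
    have := ArithCircuit.complexity_le_size (ArithCircuit.IsFanInTwo.ofConst (1 : ℝ≥0))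
      (ArithCircuit.eval_ofConst (σ := σ n) (1 : ℝ≥0))
    rw [← C_1]; simpa using this
  rw [mul_one, h1, add_zero]
  exact hc n

/-- **Jerrum–Snir for weighted circuits.**  Every fan-in-two circuit over `ℝ≥0` (weighted sum
gates allowed — the tree's `complexity` model, not only Jerrum–Snir's plain one) computing
`ST_N`, `N ≥ 60`, has at least `2^{N/20}` product gates.  The proof is the tree's
`JerrumSnir1982_spanningTree_holds` verbatim: its decomposition engine `exists_decomposition`
never used plainness. [cite: JerrumSnir1982, §4.5 and §5.1] -/
theorem two_rpow_le_prodCount {N : ℕ} (hN : 60 ≤ N)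
    {P : ArithCircuit ℝ≥0 (Fin N × Option (Fin N))} (hP2 : P.IsFanInTwo)
    (hP : P.Computes (stPoly ℝ≥0 N)) : (2 : ℝ) ^ ((1 / 20 : ℝ) * N) ≤ prodCount P := by
  have heval : P.eval = stPoly ℝ≥0 N := hP
  -- (1) the balanced decomposition with `m = ⌊N/3⌋`
  have hm1 : 1 ≤ N / 3 := by omega
  have hmN : N / 3 < N := by omega
  obtain ⟨L, hLlen, hLsum, hLdeg⟩ :=
    Literature.Barriers.ValiantsHypothesis.exists_decomposition hm1 hmN _ P le_rfl hP2
      (by rw [heval]; exact stPoly_isHomogeneous ℝ≥0 N)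
  rw [heval] at hLsum
  -- (2) every product has few monomials
  have hN1 : 1 ≤ N := by omega
  have hNpos : (0 : ℝ) < N := by exact_mod_cast hN1
  set r : ℝ := (9 + 8 * N) / 9 with hr
  have hrpos : 0 < r := by positivity
  have hterm : ∀ ab ∈ L, ((ab.1 * ab.2).support.card : ℝ) ≤ r ^ N := by
    intro ab hab
    by_cases hb : ab.2 = 0
    · simp only [hb, mul_zero, support_zero, card_empty, Nat.cast_zero]
      positivity
    have hdeg := hLdeg ab hab
    have ha : ab.1 ≠ 0 := by
      intro ha
      rw [ha, totalDegree_zero] at hdeg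
      omega
    have hsub : (ab.1 * ab.2).support ⊆ (stPoly ℝ≥0 N).support := by
      obtain ⟨q, hq⟩ := exists_sum_eq_add_of_mem (fun ab : MvPolynomial _ ℝ≥0 × _ => ab.1 * ab.2)
        L ab hab
      exact support_subset_of_eq_add (hLsum.trans hq)
    obtain ⟨hkN, hcard⟩ := card_support_mul_le hN1 hsub ha hb
    refine hcard.trans (pow_le_pow_left₀ (by positivity) ?_ N)
    have hT := nine_mul_bound_le hdeg.1 hdeg.2
    rw [div_le_iff₀ hNpos, hr]
    have hT' : (9 : ℝ) * ((N + ab.1.totalDegree ^ 2 + (N - ab.1.totalDegree) ^ 2 +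
        ab.1.totalDegree * (N - ab.1.totalDegree) : ℕ) : ℝ) ≤ 9 * N + 8 * (N : ℝ) ^ 2 := by
      exact_mod_cast hT
    nlinarith [hT']
  -- (3) counting monomials: `(N+1)^(N-1) ≤ prodCount P · r^N`
  have hcount : ((N : ℝ) + 1) ^ (N - 1) ≤ prodCount P * r ^ N := by
    have h1 := card_support_sum_le L (r ^ N) hterm
    rw [← hLsum, card_support_stPoly_eq] at h1
    push_cast at h1
    refine h1.trans ?_
    gcongr
  -- (4) arithmetic: `2^(N/20) (N+1) r^N ≤ (N+1)^N`
  have hq : (28 / 25 : ℝ) ≤ 9 * ((N : ℝ) + 1) / (9 + 8 * N) := ratio_ge (by omega)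
  have hqr : 9 * ((N : ℝ) + 1) / (9 + 8 * N) * r = N + 1 := by
    rw [hr]; field_simp
  have hkey : (2 : ℝ) ^ ((1 / 20 : ℝ) * N) * ((N : ℝ) + 1) * r ^ N ≤ ((N : ℝ) + 1) ^ N := by
    calc (2 : ℝ) ^ ((1 / 20 : ℝ) * N) * ((N : ℝ) + 1) * r ^ N
        ≤ (26 / 25 : ℝ) ^ N * (14 / 13 : ℝ) ^ N * r ^ N := by
          gcongr
          · exact two_rpow_div_twenty_le N
          · exact succ_le_pow_of_sixty_le hN
      _ = (28 / 25 : ℝ) ^ N * r ^ N := by rw [← mul_pow]; norm_num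
      _ ≤ (9 * ((N : ℝ) + 1) / (9 + 8 * N)) ^ N * r ^ N := by gcongr
      _ = ((N : ℝ) + 1) ^ N := by rw [← mul_pow, hqr]
  have hpow : ((N : ℝ) + 1) ^ N = ((N : ℝ) + 1) * ((N : ℝ) + 1) ^ (N - 1) := by
    rw [← pow_succ']; congr 1; omega
  rw [hpow] at hkey
  have hN1' : (0 : ℝ) < (N : ℝ) + 1 := by positivity
  have h5 : (2 : ℝ) ^ ((1 / 20 : ℝ) * N) * r ^ N ≤ ((N : ℝ) + 1) ^ (N - 1) := by
    have := hkey
    rw [mul_comm ((2 : ℝ) ^ _) ((N : ℝ) + 1), mul_assoc] at this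
    exact le_of_mul_le_mul_left this hN1'
  have h6 : (2 : ℝ) ^ ((1 / 20 : ℝ) * N) * r ^ N ≤ prodCount P * r ^ N := h5.trans hcount
  exact le_of_mul_le_mul_right h6 (pow_pos hrpos N)

/-- **Monotone complexity of `ST` in the tree's model**: `2^{N/20} ≤ L_{ℝ≥0}(ST_N)` for
`N ≥ 60` (weighted fan-in-two circuits over `ℝ≥0`). [cite: JerrumSnir1982, §4.5 and §5.1] -/
theorem complexity_stPoly_ge {N : ℕ} (hN : 60 ≤ N) :
    (2 : ℝ) ^ ((1 / 20 : ℝ) * N) ≤ complexity (stPoly ℝ≥0 N) := by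
  obtain ⟨P, h2, hP, hsize⟩ := ArithCircuit.exists_computes_size_eq_complexity (stPoly ℝ≥0 N)
  calc (2 : ℝ) ^ ((1 / 20 : ℝ) * N) ≤ prodCount P := two_rpow_le_prodCount hN h2 hP
    _ ≤ (P.size : ℝ) := by exact_mod_cast prodCount_le_size P
    _ = complexity (stPoly ℝ≥0 N) := by rw [hsize]

/-- The quasi-polynomial bound loses to `2^{N/20}`: for every `c` there is `N ≥ 60` with
`20 (log₂ N + c)^c < N` (take `N = 2^L`, `L` large: `L^{c+1} ≤ 2^L`). [folklore] -/
theorem exists_qp_lt (c : ℕ) : ∃ N : ℕ, 60 ≤ N ∧ 20 * (Nat.log 2 N + c) ^ c < N := by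
  have ht := tendsto_pow_const_div_const_pow_of_one_lt (c + 1) (one_lt_two (α := ℝ))
  have hev : ∀ᶠ m : ℕ in atTop, (m : ℝ) ^ (c + 1) / 2 ^ m ≤ 1 :=
    ht.eventually (ge_mem_nhds one_pos)
  obtain ⟨N₀, hN₀⟩ := eventually_atTop.1 hev
  set L : ℕ := max (max N₀ (20 * 2 ^ c + 1)) (max c 6) with hLdef
  have hL0 : N₀ ≤ L := le_trans (le_max_left _ _) (le_max_left _ _)
  have hL1 : 20 * 2 ^ c + 1 ≤ L := le_trans (le_max_right _ _) (le_max_left _ _)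
  have hLc : c ≤ L := le_trans (le_max_left _ _) (le_max_right _ _)
  have hL6 : 6 ≤ L := le_trans (le_max_right _ _) (le_max_right _ _)
  refine ⟨2 ^ L, ?_, ?_⟩
  · calc 60 ≤ 2 ^ 6 := by norm_num
      _ ≤ 2 ^ L := Nat.pow_le_pow_right two_pos hL6
  rw [Nat.log_pow one_lt_two]
  have h1 : (L : ℝ) ^ (c + 1) / 2 ^ L ≤ 1 := hN₀ L hL0
  rw [div_le_one (by positivity)] at h1
  have h2 : L ^ (c + 1) ≤ 2 ^ L := by exact_mod_cast h1
  have hpos : 1 ≤ L ^ c := Nat.one_le_pow _ _ (by omega)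
  calc 20 * (L + c) ^ c ≤ 20 * (2 * L) ^ c :=
        Nat.mul_le_mul_left _ (Nat.pow_le_pow_left (by omega) c)
    _ = 20 * 2 ^ c * L ^ c := by rw [mul_pow]; ring
    _ < (20 * 2 ^ c + 1) * L ^ c := by nlinarith
    _ ≤ L * L ^ c := Nat.mul_le_mul_right _ hL1
    _ = L ^ (c + 1) := by ring
    _ ≤ 2 ^ L := h2

/-- `ST` over `ℝ≥0` has coefficients in `{0, 1}`. [cite: JerrumSnir1982, §4.5] -/
theorem coeff_stPoly_zero_or_one (N : ℕ) (m : (Fin N × Option (Fin N)) →₀ ℕ) :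
    coeff m (stPoly ℝ≥0 N) = 0 ∨ coeff m (stPoly ℝ≥0 N) = 1 := by
  rw [coeff_stPoly]
  split_ifs <;> simp

/-- **(B) `¬ ZeroOneTransferNoDivision`.**  The spanning tree family `ST_N` has 0/1
coefficients, its complexification `ST_N ∈ ℂ[x]` is in `VP_ℂ` (directed matrix-tree theorem,
`isVPFamily_stPoly_holds`), and its monotone complexity is `≥ 2^{N/20}` (`complexity_stPoly_ge`),
which beats `2^{(log₂ N + c)^c}` at the `N` of `exists_qp_lt c`.  Hence the cofactor `h` in the
crux is load-bearing: only division-robust monotone lower bounds can refute `ZeroOneTransfer`,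
and for this witness none exists (FGK14 Thm 7.2: `ST` is division-easy). [cite: JerrumSnir1982, §4.5 and §5.1] -/
theorem not_zeroOneTransferNoDivision : ¬ ZeroOneTransferNoDivision := by
  intro H
  have hmap : (fun N => map (Complex.ofRealHom.comp NNReal.toRealHom) (stPoly ℝ≥0 N)) =
      fun N => stPoly ℂ N := by
    funext N; exact map_stPoly _ N
  have hVP : IsVPFamily (k := ℂ)
      (fun N => map (Complex.ofRealHom.comp NNReal.toRealHom) (stPoly ℝ≥0 N)) := by
    rw [hmap]; exact isVPFamily_stPoly_holds ℂ
  obtain ⟨c, hc⟩ := H (fun N => Fin N × Option (Fin N)) (fun N => stPoly ℝ≥0 N)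
    coeff_stPoly_zero_or_one hVP
  obtain ⟨N, hN, hlt⟩ := exists_qp_lt c
  have hlow := complexity_stPoly_ge hN
  have hcN := hc N
  generalize (Nat.log 2 N + c) ^ c = E at hlt hcN
  have hup : (complexity (stPoly ℝ≥0 N) : ℝ) ≤ (2 : ℝ) ^ ((E : ℕ) : ℝ) := by
    rw [Real.rpow_natCast]; exact_mod_cast hcN
  have h1 : (1 / 20 : ℝ) * N ≤ ((E : ℕ) : ℝ) :=
    (Real.rpow_le_rpow_left_iff one_lt_two).mp (hlow.trans hup)
  have h2 : (N : ℝ) ≤ 20 * ((E : ℕ) : ℝ) := by linarith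
  have h3 : N ≤ 20 * E := by exact_mod_cast h2
  omega

/-! ### (C) The kill criterion, formally: crux 4 + Kasteleyn ⇒ ¬ crux -/

/-- Exponent vector of the monomial `Π_v X (v, f v)` at `(a, b)`: `1` if `f a = b`, else `0`.
[folklore] -/
theorem sum_single_graph_apply {α β : Type*} [Fintype α] [DecidableEq α] [DecidableEq β]
    (f : α → β) (a : α) (b : β) :
    (∑ v : α, Finsupp.single (v, f v) (1 : ℕ)) (a, b) = if f a = b then 1 else 0 := by
  rw [Finsupp.coe_finsetSum, Finset.sum_apply, Finset.sum_eq_single a]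
  · by_cases h : f a = b
    · simp [h]
    · rw [if_neg h, Finsupp.single_apply, if_neg]
      intro hab; exact h (Prod.ext_iff.mp hab).2
  · intro v _ hv
    rw [Finsupp.single_apply, if_neg]
    intro hab; exact hv (Prod.ext_iff.mp hab).1
  · intro ha; exact absurd (Finset.mem_univ a) ha

/-- Distinct maps have distinct graph monomials. [folklore] -/
theorem sum_single_graph_injective {α β : Type*} [Fintype α] [DecidableEq α] [DecidableEq β] :
    Function.Injective fun f : α → β => ∑ v : α, Finsupp.single (v, f v) (1 : ℕ) := by
  intro f g hfg
  funext a
  have h := congrArg (fun e => e (a, f a)) hfg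
  simp only [sum_single_graph_apply, ite_true] at h
  by_cases hg : g a = f a
  · exact hg.symm
  · rw [if_neg hg] at h; exact absurd h one_ne_zero

/-- The graph monomial as a `monomial`. [folklore] -/
theorem prod_X_graph_eq_monomial {α β : Type*} [Fintype α] [DecidableEq α] [DecidableEq β]
    (R : Type*) [CommSemiring R] (f : α → β) :
    ∏ v : α, (X (v, f v) : MvPolynomial (α × β) R) =
      monomial (∑ v : α, Finsupp.single (v, f v) (1 : ℕ)) 1 := by
  rw [monomial_sum_one]
  rfl

/-- **Graph polynomials have 0/1 coefficients**: for every finite set `S` of maps `α → β`, every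
coefficient of `Σ_{f ∈ S} Π_v X (v, f v)` is `0` or `1` (covers the dimer sums of cruxes
`TriangularDimersDivisionEasy`, `SquareGridDimersDivisionEasy` and the arborescence sum of
`StDivisionEasy`). [folklore] -/
theorem coeff_sum_prod_X_graph {α β : Type*} [Fintype α] [DecidableEq α] [DecidableEq β]
    (R : Type*) [CommSemiring R] (S : Finset (α → β)) (m : (α × β) →₀ ℕ) :
    coeff m (∑ f ∈ S, ∏ v : α, (X (v, f v) : MvPolynomial (α × β) R)) = 0 ∨
      coeff m (∑ f ∈ S, ∏ v : α, (X (v, f v) : MvPolynomial (α × β) R)) = 1 := by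
  classical
  simp_rw [prod_X_graph_eq_monomial R]
  rw [coeff_sum]
  simp only [coeff_monomial]
  rw [Finset.sum_boole]
  have hcard : (S.filter fun f : α → β =>
      (∑ v : α, Finsupp.single (v, f v) (1 : ℕ)) = m).card ≤ 1 := by
    refine Finset.card_le_one.mpr ?_
    intro f hf g hg
    simp only [Finset.mem_filter] at hf hg
    exact sum_single_graph_injective (hf.2.trans hg.2.symm)
  rcases Nat.le_one_iff_eq_zero_or_eq_one.mp hcard with h0 | h1
  · left; simp [h0]
  · right; simp [h1]

/-- **Kill criterion (C).**  If the complexified triangular-lattice dimer family `D_n` of crux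
`TriangularDimersDivisionEasy` is in `VP_ℂ` — Kasteleyn's Pfaffian orientation (FKT; Valiant
1980 Thm 2), NOT in the tree, entered as hypothesis `hVP` — and crux 4 fails, then the crux fails:
`D_n` has 0/1 coefficients and the crux's conclusion for `f = D` is literally
`TriangularDimersDivisionEasy`.  Probe data for crux 4 (kit job j008644, script `kuo_probe.py`;
local runs agree): on the rhombus `T_n`, `n = 4, 6`, the 4-point plane condensation identity is
`M(G)M(G−abcd) + M(G−ac)M(G−bd) = M(G−ab)M(G−cd) + M(G−ad)M(G−bc)` for ALL boundary quadruples
(`495 / 4845` checked with random positive weights), and the same-side companion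
`M(G−ac)M(G−bd)` vanishes ONLY in the `2·(|∂T_n| − 3)` degenerate quadruples at the two acute
(degree-2) corners (`18 / 34` cases) — where the identity is mere vertex expansion.  So every
genuine 4-point condensation step on `T_n` subtracts; no subtraction-free exchange identity of
Kuo type exists there (evidence, not proof, for `¬` crux 4).
[cite: Valiant1980, §3 Thm. 2] [cite: Kuo2004, Thm. 2.1 and 2.3] -/
theorem zeroOneTransfer_false_of_triangularDimers_hard
    (hVP : IsVPFamily (k := ℂ) fun n => MvPolynomial.map (Complex.ofRealHom.comp NNReal.toRealHom)
      (∑ f ∈ (Finset.univ : Finset (Fin n × Fin n → Fin n × Fin n)).filter (fun f => ∀ v, f (f v) = v ∧ f v ≠ v ∧ (((v.1 : ℕ) + 1 = (f v).1 ∧ (v.2 : ℕ) = (f v).2) ∨ (((f v).1 : ℕ) + 1 = v.1 ∧ (v.2 : ℕ) = (f v).2) ∨ ((v.1 : ℕ) = (f v).1 ∧ (v.2 : ℕ) + 1 = (f v).2) ∨ ((v.1 : ℕ) = (f v).1 ∧ ((f v).2 : ℕ) + 1 = v.2) ∨ ((v.1 : ℕ) + 1 = (f v).1 ∧ ((f v).2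 : ℕ) + 1 = v.2) ∨ (((f v).1 : ℕ) + 1 = v.1 ∧ (v.2 : ℕ) + 1 = (f v).2))), ∏ v : Fin n × Fin n, (MvPolynomial.X (v, f v) : MvPolynomial ((Fin n × Fin n) × (Fin n × Fin n)) NNReal)))
    (hhard : ¬ TriangularDimersDivisionEasy) : ¬ ZeroOneTransfer := by
  intro H
  apply hhard
  classical
  exact H (fun n => (Fin n × Fin n) × (Fin n × Fin n)) _
    (fun n m => by convert coeff_sum_prod_X_graph ℝ≥0 _ m) hVP

/-! ### (D) Division-easiness descends to faces and positive specialisations (cycle 2)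

Uses the landed `Theorems/ZeroOneTransfer/Negative/TopComponentFree.lean` (`topComponent`,
initial forms are free).  Landing as `Negative/Faces.lean`. -/

section FacesD

open Summit.ValiantsHypothesis.ValiantsHypothesis.Theorems.ZeroOneTransfer.Negative
  (topComponent topComponent_mul topComponent_ne_zero complexity_topComponent_le)

section DivComplexity2

variable {k : Type*} [CommSemiring k] {σ : Type*}

/-- Any nonzero cofactor bounds the division complexity. [folklore] -/
theorem divComplexity_le_of_ne_zero (f : MvPolynomial σ k) {h : MvPolynomial σ k} (hh : h ≠ 0) :
    divComplexity f ≤ complexity (f * h) + complexity h :=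
  Nat.sInf_le ⟨h, hh, rfl⟩

end DivComplexity2

/-! ### Initial forms are free for division complexity -/

section Top

variable {σ : Type*}

/-- **`divC (top_w f) ≤ divC f`** over `ℝ≥0`, for every weight `w : σ → ℕ`: take an optimal
cofactor `h`; `top_w (f h) = top_w f · top_w h` (`topComponent_mul`), `top_w h ≠ 0`
(`topComponent_ne_zero`), and both `top_w (f h)` and `top_w h` are no harder than `f h`, `h`
(`complexity_topComponent_le`).  So the class of division-easy families is closed under all
toric degenerations, at zero cost (lemma B2 of crux card `free-degeneration`). [folklore] -/
theorem divComplexity_topComponent_le (w : σ → ℕ) (f : MvPolynomial σ ℝ≥0) :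
    divComplexity (topComponent w f) ≤ divComplexity f := by
  obtain ⟨h, hne, heq⟩ := exists_eq_divComplexity f
  rw [← heq]
  calc divComplexity (topComponent w f)
      ≤ complexity (topComponent w f * topComponent w h) + complexity (topComponent w h) :=
        divComplexity_le_of_ne_zero _ (topComponent_ne_zero w hne)
    _ = complexity (topComponent w (f * h)) + complexity (topComponent w h) := by
        rw [topComponent_mul]
    _ ≤ complexity (f * h) + complexity h :=
        Nat.add_le_add (complexity_topComponent_le w _) (complexity_topComponent_le w _)

end Top

/-! ### Positive specialisations are free for division complexity -/

section Pos

variable {σ τ : Type*}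

/-- Evaluation commutes with substitution. [folklore] -/
theorem eval_aeval_eq {R : Type*} [CommSemiring R] (x : τ → R) (e : σ → MvPolynomial τ R)
    (p : MvPolynomial σ R) : eval x (aeval e p) = eval (fun i => eval x (e i)) p := by
  induction p using MvPolynomial.induction_on with
  | C a => simp
  | add p q hp hq => rw [map_add, map_add, hp, hq, map_add]
  | mul_X p i hp => rw [map_mul, map_mul, hp, aeval_X, map_mul, eval_X]

/-- Over `ℝ≥0` a nonzero polynomial does not vanish at a point with nonzero coordinates.
[folklore] -/
theorem eval_ne_zero_of_ne_zero {p : MvPolynomial σ ℝ≥0} (hp : p ≠ 0) {y : σ → ℝ≥0}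
    (hy : ∀ i, y i ≠ 0) : eval y p ≠ 0 := by
  classical
  obtain ⟨d, hd⟩ := exists_coeff_ne_zero hp
  rw [eval_eq]
  intro h0
  have hterm : coeff d p * ∏ i ∈ d.support, y i ^ d i ≠ 0 :=
    mul_ne_zero hd (Finset.prod_ne_zero_iff.mpr fun i _ => pow_ne_zero _ (hy i))
  have hle : coeff d p * ∏ i ∈ d.support, y i ^ d i ≤
      ∑ e ∈ p.support, coeff e p * ∏ i ∈ e.support, y i ^ e i :=
    Finset.single_le_sum (f := fun e => coeff e p * ∏ i ∈ e.support, y i ^ e i)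
      (fun _ _ => zero_le) (mem_support_iff.mpr hd)
  rw [h0] at hle
  exact hterm (le_antisymm hle zero_le)

/-- A POSITIVE substitution (variables, or NONZERO constants) keeps nonzero polynomials nonzero
over `ℝ≥0` (evaluate at the all-ones point). [folklore] -/
theorem aeval_ne_zero_of_pos (e : σ → MvPolynomial τ ℝ≥0)
    (he : ∀ i, (∃ j, e i = X j) ∨ ∃ c : ℝ≥0, c ≠ 0 ∧ e i = C c)
    {p : MvPolynomial σ ℝ≥0} (hp : p ≠ 0) : aeval e p ≠ 0 := by
  intro h0
  have h1 : eval (fun _ => (1 : ℝ≥0)) (aeval e p) = 0 := by rw [h0, map_zero]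
  rw [eval_aeval_eq] at h1
  refine eval_ne_zero_of_ne_zero hp (y := fun i => eval (fun _ => (1 : ℝ≥0)) (e i)) ?_ h1
  intro i
  rcases he i with ⟨j, hj⟩ | ⟨c, hc, hci⟩
  · rw [hj, eval_X]; exact one_ne_zero
  · rw [hci, eval_C]; exact hc

/-- **`divC (f(e)) ≤ divC f` for positive substitutions** `e` (each variable to a variable or a
nonzero constant): substitute into both circuits of an optimal certificate `f·h = g`; the
cofactor `h(e)` stays nonzero (`aeval_ne_zero_of_pos`) and projections cost nothing
(`complexity_le_of_isProjection`).  Lemma A1 of crux card `arborescence-span`; used by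
refuters to degenerate a `VP` family before attacking it. [folklore] -/
theorem divComplexity_aeval_le_of_pos (e : σ → MvPolynomial τ ℝ≥0)
    (he : ∀ i, (∃ j, e i = X j) ∨ ∃ c : ℝ≥0, c ≠ 0 ∧ e i = C c) (f : MvPolynomial σ ℝ≥0) :
    divComplexity (aeval e f) ≤ divComplexity f := by
  obtain ⟨h, hne, heq⟩ := exists_eq_divComplexity f
  rw [← heq]
  have hproj : ∀ p : MvPolynomial σ ℝ≥0, IsProjection (aeval e p) p := fun p =>
    ⟨e, fun i => (he i).imp id (fun ⟨c, _, hc⟩ => ⟨c, hc⟩), rfl⟩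
  calc divComplexity (aeval e f)
      ≤ complexity (aeval e f * aeval e h) + complexity (aeval e h) :=
        divComplexity_le_of_ne_zero _ (aeval_ne_zero_of_pos e he hne)
    _ = complexity (aeval e (f * h)) + complexity (aeval e h) := by rw [map_mul]
    _ ≤ complexity (f * h) + complexity h :=
        Nat.add_le_add (complexity_le_of_isProjection (hproj _))
          (complexity_le_of_isProjection (hproj _))

/-- Injective renamings do not change division complexity downwards: `divC p ≤ divC (rename ι p)`
(pull back along `ι`, sending the unused variables to `1`). [folklore] -/
theorem divComplexity_le_rename {ι : σ → τ} (hι : Function.Injective ι) [DecidableEq τ]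
    (p : MvPolynomial σ ℝ≥0) : divComplexity p ≤ divComplexity (rename ι p) := by
  classical
  -- the pull-back substitution
  let e : τ → MvPolynomial σ ℝ≥0 := fun v =>
    if hv : ∃ i, ι i = v then X hv.choose else C 1
  have he : ∀ v, (∃ j, e v = X j) ∨ ∃ c : ℝ≥0, c ≠ 0 ∧ e v = C c := by
    intro v
    by_cases hv : ∃ i, ι i = v
    · left; exact ⟨hv.choose, by simp [e, hv]⟩
    · right; exact ⟨1, one_ne_zero, by simp [e, hv]⟩
  have hpull : aeval e (rename ι p) = p := by
    rw [aeval_rename]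
    have hcomp : (e ∘ ι) = X := by
      funext i
      have hv : ∃ i', ι i' = ι i := ⟨i, rfl⟩
      simp only [Function.comp_apply, e, dif_pos hv]
      congr 1
      exact hι hv.choose_spec
    rw [hcomp, aeval_X_left, AlgHom.id_apply]
  calc divComplexity p = divComplexity (aeval e (rename ι p)) := by rw [hpull]
    _ ≤ divComplexity (rename ι p) := divComplexity_aeval_le_of_pos e he _

end Pos

/-! ### (D) Kill criterion: a hard face kills the crux -/

section Kill

open Summit.ValiantsHypothesis.ValiantsHypothesis.Theses.DivisionGap (PerDivisionHard)

/-- The crux bounds the division complexity of EVERY FACE of every 0/1 `VP_ℂ` family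
(the card's `FaceClosure`, a consequence of the crux by `divComplexity_topComponent_le`).
[folklore] -/
theorem isQPBounded_divComplexity_face_of_zeroOneTransfer (H : ZeroOneTransfer)
    (σ : ℕ → Type) [∀ n, Fintype (σ n)] (f : ∀ n, MvPolynomial (σ n) ℝ≥0)
    (w : ∀ n, σ n → ℕ) (h01 : ∀ n m, coeff m (f n) = 0 ∨ coeff m (f n) = 1)
    (hVP : IsVPFamily (k := ℂ) fun n => map (Complex.ofRealHom.comp NNReal.toRealHom) (f n)) :
    IsQPBounded fun n => divComplexity (topComponent (w n) (f n)) := by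
  obtain ⟨c, hc⟩ := H σ f h01 hVP
  refine ⟨c, fun n => ?_⟩
  obtain ⟨h, hne, hle⟩ := hc n
  exact ((divComplexity_topComponent_le (w n) (f n)).trans
    (divComplexity_le_of_ne_zero _ hne)).trans hle

/-- **Kill criterion (D).**  A 0/1 `VP_ℂ` family with ONE super-quasi-polynomially
division-hard face polynomial refutes `ZeroOneTransfer`.  (The cheapest place to break the
crux: faces of `VP` families are only known to lie in the border class `VP‾`, not in `VP`.)
[folklore] -/
theorem zeroOneTransfer_false_of_hard_face
    (hex : ∃ (σ : ℕ → Type) (_ : ∀ n, Fintype (σ n)) (f : ∀ n, MvPolynomial (σ n) ℝ≥0)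
      (w : ∀ n, σ n → ℕ), (∀ n m, coeff m (f n) = 0 ∨ coeff m (f n) = 1) ∧
      IsVPFamily (k := ℂ) (fun n => map (Complex.ofRealHom.comp NNReal.toRealHom) (f n)) ∧
      ¬ IsQPBounded fun n => divComplexity (topComponent (w n) (f n))) :
    ¬ ZeroOneTransfer := by
  intro H
  obtain ⟨σ, _, f, w, h01, hVP, hnot⟩ := hex
  exact hnot (isQPBounded_divComplexity_face_of_zeroOneTransfer H σ f w h01 hVP)

/-- **Route consistency: H1 ∧ H2 ⇒ the permanent is not a face of a 0/1 `VP` family.**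
If for some 0/1 `VP_ℂ` family `f`, weights `w n` and sizes `m n ≥ n`, the face polynomial
`top_{w n} (f n)` is the permanent `per_{m n}` up to an injective renaming of its variables,
then `PerDivisionHard ∧ ZeroOneTransfer` fails: H2 makes the face, hence (renaming and
initial forms being free) `per_{m n}`, division-easy at level `2^((log₂ n + c)^c) ≤
2^((log₂ (m n) + c)^c)` for ALL `n`, and H1 with the same `c` forbids this from `n₀` on.
[folklore] -/
theorem not_perDivisionHard_and_zeroOneTransfer_of_perFace
    (hex : ∃ (σ : ℕ → Type) (_ : ∀ n, Fintype (σ n)) (_ : ∀ n, DecidableEq (σ n))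
      (f : ∀ n, MvPolynomial (σ n) ℝ≥0) (w : ∀ n, σ n → ℕ) (m : ℕ → ℕ)
      (ι : ∀ n, Fin (m n) × Fin (m n) → σ n),
      (∀ n m', coeff m' (f n) = 0 ∨ coeff m' (f n) = 1) ∧
      IsVPFamily (k := ℂ) (fun n => map (Complex.ofRealHom.comp NNReal.toRealHom) (f n)) ∧
      (∀ n, n ≤ m n) ∧ (∀ n, Function.Injective (ι n)) ∧
      ∀ n, topComponent (w n) (f n) = rename (ι n) (perPoly (Fin (m n)) ℝ≥0)) :
    ¬ (PerDivisionHard ∧ ZeroOneTransfer) := by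
  rintro ⟨H1, H2⟩
  obtain ⟨σ, _, _, f, w, m, ι, h01, hVP, hm, hι, hface⟩ := hex
  obtain ⟨c, hc⟩ := isQPBounded_divComplexity_face_of_zeroOneTransfer H2 σ f w h01 hVP
  obtain ⟨n₀, hn₀⟩ := H1 c
  -- division complexity of `per_{m n₀}`
  have hper : divComplexity (perPoly (Fin (m n₀)) ℝ≥0) ≤ 2 ^ ((Nat.log 2 n₀ + c) ^ c) := by
    calc divComplexity (perPoly (Fin (m n₀)) ℝ≥0)
        ≤ divComplexity (rename (ι n₀) (perPoly (Fin (m n₀)) ℝ≥0)) :=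
          divComplexity_le_rename (hι n₀) _
      _ = divComplexity (topComponent (w n₀) (f n₀)) := by rw [hface]
      _ ≤ 2 ^ ((Nat.log 2 n₀ + c) ^ c) := hc n₀
  obtain ⟨h, hne, heq⟩ := exists_eq_divComplexity (perPoly (Fin (m n₀)) ℝ≥0)
  have hlt := hn₀ (m n₀) (hm n₀) h hne
  have hmono : 2 ^ ((Nat.log 2 n₀ + c) ^ c) ≤ 2 ^ ((Nat.log 2 (m n₀) + c) ^ c) :=
    Nat.pow_le_pow_right two_pos
      (Nat.pow_le_pow_left (Nat.add_le_add_right (Nat.log_mono_right (hm n₀)) c) c)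
  rw [heq] at hlt
  exact absurd (hmono.trans_lt hlt) (not_lt.mpr hper)

end Kill

end FacesD

/-! ### (E) Cofactors on few rows and Pólya multipliers of any degree never help (cycle 2)

Uses the landed `Negative/LowDegreeCofactor.lean`, `Negative/KillRows.lean`.  Landing as
`Negative/Polya.lean`. -/

section PolyaE

open Summit.ValiantsHypothesis.ValiantsHypothesis.Theorems.ZeroOneTransfer.Negative
  (topComponent topComponent_mul topComponent_ne_zero complexity_topComponent_le
   topComponent_eq_self_of_isWeightedHomogeneous rowWeight isWeightedHomogeneous_stPoly killRows
   sum_coeff_ne_zero isProjection_killRows aeval_killRows_eq_C two_rpow_le_complexity_of_support_eq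
   support_aeval_killRows_stPoly topComponent_one support_topComponent_subset coeff_topComponent
   exists_qp_lt_forty)

section Polya

variable {N : ℕ}

/-! ### Cofactors on few rows -/

/-- **A cofactor whose row-lexicographic initial form lives on the rows `R` buys at most `|R|`
rows of the spanning-tree polynomial**: `2^{(N - |R|)/20} ≤ L_{ℝ≥0}(ST_N · h) + 1` whenever
`|R| + 60 ≤ N`.  Same proof as `two_rpow_le_complexity_stPoly_mul` (initial form free, `killRows`,
Jerrum–Snir by support), with the row set as a hypothesis instead of the degree. [folklore] -/
theorem two_rpow_le_complexity_stPoly_mul_of_rows {h : MvPolynomial (Fin N × Option (Fin N)) ℝ≥0}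
    (hh : h ≠ 0) (B : ℕ) (R : Finset (Fin N))
    (hrows : ∀ d ∈ (topComponent (rowWeight B) h).support, ∀ v ∈ d.support, v.1 ∈ R)
    (hR : R.card + 60 ≤ N) :
    (2 : ℝ) ^ ((1 / 20 : ℝ) * (N - R.card : ℕ)) ≤ complexity (stPoly ℝ≥0 N * h) + 1 := by
  classical
  set W := rowWeight (N := N) (β := Option (Fin N)) B with hW
  set hs := topComponent W h with hhs
  have hne : hs ≠ 0 := topComponent_ne_zero _ hh
  set M := Fintype.card {i : Fin N // i ∉ R} with hM
  have hMeq : M = N - R.card := by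
    rw [hM, Fintype.card_subtype_compl, Fintype.card_fin, Fintype.card_coe]
  have hM60 : 60 ≤ M := by omega
  let e : {i : Fin N // i ∉ R} ≃ Fin M := Fintype.equivFin _
  -- (1) initial form
  have h1 : complexity (stPoly ℝ≥0 N * hs) ≤ complexity (stPoly ℝ≥0 N * h) := by
    have := complexity_topComponent_le W (stPoly ℝ≥0 N * h)
    rwa [topComponent_mul, topComponent_eq_self_of_isWeightedHomogeneous W
      (isWeightedHomogeneous_stPoly B)] at this
  -- (2) projection
  set q := aeval (killRows R e) (stPoly ℝ≥0 N) with hq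
  set η : ℝ≥0 := ∑ d ∈ hs.support, coeff d hs with hη
  have hη0 : η ≠ 0 := sum_coeff_ne_zero hne
  have h2 : complexity (q * C η) ≤ complexity (stPoly ℝ≥0 N * hs) := by
    have := complexity_le_of_isProjection (isProjection_killRows R e (stPoly ℝ≥0 N * hs))
    rwa [map_mul, aeval_killRows_eq_C R e hrows] at this
  -- (3) unscale
  have h3 : complexity q ≤ complexity (q * C η) + 1 := by
    have hqq : q = η⁻¹ • (q * C η) := by
      rw [mul_comm, smul_eq_C_mul, ← mul_assoc, ← C_mul, inv_mul_cancel₀ hη0, C_1, one_mul]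
    conv_lhs => rw [hqq]
    exact complexity_smul_le_holds _ _
  -- (4) Jerrum–Snir by support on `Fin M`
  have h4 : (2 : ℝ) ^ ((1 / 20 : ℝ) * M) ≤ complexity q :=
    two_rpow_le_complexity_of_support_eq hM60 (support_aeval_killRows_stPoly R e)
  rw [← hMeq]
  calc (2 : ℝ) ^ ((1 / 20 : ℝ) * (M : ℕ)) ≤ complexity q := h4
    _ ≤ (complexity (q * C η) : ℝ) + 1 := by exact_mod_cast h3
    _ ≤ (complexity (stPoly ℝ≥0 N * h) : ℝ) + 1 := by
        have h21 : (complexity (q * C η) : ℝ) ≤ complexity (stPoly ℝ≥0 N * h) := by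
          exact_mod_cast h2.trans h1
        linarith

/-! ### Pólya multipliers: the initial form of `(a + Σ x)^M` lives on the last row -/

section LinPow

variable {σ : Type*}

/-- Top components of powers. [folklore] -/
theorem topComponent_pow (w : σ → ℕ) (p : MvPolynomial σ ℝ≥0) (M : ℕ) :
    topComponent w (p ^ M) = topComponent w p ^ M := by
  induction M with
  | zero => rw [pow_zero, pow_zero]; exact topComponent_one w
  | succ M ih => rw [pow_succ, pow_succ, topComponent_mul, ih]

/-- Variables of a power come from variables of the base. [folklore] -/
theorem vars_of_mem_support_pow {p : MvPolynomial σ ℝ≥0} {P : σ → Prop}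
    (hp : ∀ d ∈ p.support, ∀ v ∈ d.support, P v) (M : ℕ) :
    ∀ d ∈ (p ^ M).support, ∀ v ∈ d.support, P v := by
  classical
  induction M with
  | zero =>
    intro d hd v hv
    rw [pow_zero] at hd
    have hd0 : d = 0 := by
      by_contra hne
      rw [mem_support_iff, coeff_one, if_neg (Ne.symm hne)] at hd
      exact hd rfl
    rw [hd0] at hv
    simp at hv
  | succ M ih =>
    intro d hd v hv
    rw [pow_succ] at hd
    obtain ⟨a, ha, b, hb, rfl⟩ := Finset.mem_add.1 (support_mul _ _ hd)
    have hv' : v ∈ a.support ∪ b.support := Finsupp.support_add hv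
    rcases Finset.mem_union.1 hv' with h | h
    · exact ih a ha v h
    · exact hp b hb v h

end LinPow

/-- The affine linear form `a + Σ_v x_v` in the variables of `ST_N`. [folklore] -/
def linForm (N : ℕ) (a : ℝ≥0) : MvPolynomial (Fin N × Option (Fin N)) ℝ≥0 :=
  C a + ∑ v : Fin N × Option (Fin N), X v

/-- The coefficient of a single variable in `a + Σ x` is `1`. [folklore] -/
theorem coeff_single_linForm (a : ℝ≥0) (v : Fin N × Option (Fin N)) :
    coeff (Finsupp.single v 1) (linForm N a) = 1 := by
  classical
  rw [linForm, coeff_add, coeff_C, if_neg (Finsupp.single_ne_zero.mpr one_ne_zero).symm,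
    zero_add, coeff_sum, Finset.sum_eq_single v]
  · exact coeff_X_same v
  · intro u _ huv
    rw [coeff_X, if_neg]
    exact fun h => huv (Finsupp.single_left_injective one_ne_zero h)
  · intro hv; exact absurd (Finset.mem_univ v) hv

/-- The support of `a + Σ x`: the constant monomial or single variables. [folklore] -/
theorem mem_support_linForm {a : ℝ≥0} {d : (Fin N × Option (Fin N)) →₀ ℕ}
    (hd : d ∈ (linForm N a).support) : d = 0 ∨ ∃ v, d = Finsupp.single v 1 := by
  classical
  rw [linForm] at hd
  rcases Finset.mem_union.1 (support_add hd) with h | h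
  · left
    have hsub : (C a : MvPolynomial (Fin N × Option (Fin N)) ℝ≥0).support ⊆ {0} := by
      rw [support_C]; split_ifs <;> simp
    simpa using hsub h
  · right
    obtain ⟨v, _, hv⟩ := Finset.mem_biUnion.1 (support_sum h)
    refine ⟨v, ?_⟩
    have hsub : (X v : MvPolynomial (Fin N × Option (Fin N)) ℝ≥0).support ⊆
        {Finsupp.single v 1} := by
      rw [support_X]
    simpa using hsub hv

/-- **The row-lexicographic initial form of a Pólya multiplier lives on the last row.**  With
base `2`, every variable of every monomial of `top ((a + Σ x)^M)` lies in row `N - 1`.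
[folklore] -/
theorem rows_topComponent_linPow (hN : 1 ≤ N) (a : ℝ≥0) (M : ℕ) :
    ∀ d ∈ (topComponent (rowWeight 2) (linForm N a ^ M)).support, ∀ v ∈ d.support,
      v.1 ∈ ({⟨N - 1, by omega⟩} : Finset (Fin N)) := by
  classical
  rw [topComponent_pow]
  refine vars_of_mem_support_pow ?_ M
  intro d hd v hv
  rw [Finset.mem_singleton]
  set W := rowWeight (N := N) (β := Option (Fin N)) 2 with hW
  -- `d` has maximal weight and lies in the support of the linear form
  have hdp : d ∈ (linForm N a).support := support_topComponent_subset W _ hd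
  have hwt : Finsupp.weight W d = weightedTotalDegree W (linForm N a) := by
    have := mem_support_iff.mp hd
    rw [coeff_topComponent] at this
    by_contra hne
    exact this (if_neg hne)
  -- the maximal weight is at least `2^(N-1)`, attained by a variable of the last row
  set v₀ : Fin N × Option (Fin N) := (⟨N - 1, by omega⟩, none) with hv₀
  have hmax : (2 : ℕ) ^ (N - 1) ≤ weightedTotalDegree W (linForm N a) := by
    have hmem : Finsupp.single v₀ 1 ∈ (linForm N a).support := by
      rw [mem_support_iff, coeff_single_linForm]; exact one_ne_zero
    have := le_weightedTotalDegree W hmem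
    rwa [Finsupp.weight_single, smul_eq_mul, one_mul] at this
  rcases mem_support_linForm hdp with rfl | ⟨u, rfl⟩
  · -- the constant monomial has weight `0 < 2^(N-1)`
    rw [map_zero] at hwt
    rw [← hwt] at hmax
    exact absurd hmax (not_le.mpr (Nat.two_pow_pos _))
  · -- a single variable `u`: weight `2^{u.1} = max ≥ 2^(N-1)` forces `u.1 = N-1`
    rw [Finsupp.weight_single, smul_eq_mul, one_mul] at hwt
    have hle : (2 : ℕ) ^ (N - 1) ≤ 2 ^ (u.1 : ℕ) := by
      rw [← hwt] at hmax; exact hmax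
    have hu : N - 1 ≤ (u.1 : ℕ) := (Nat.pow_le_pow_iff_right (by norm_num)).mp hle
    have hv' : v = u := by
      rw [Finsupp.support_single _ one_ne_zero, Finset.mem_singleton] at hv
      exact hv
    rw [hv']
    ext
    have := u.1.isLt
    simp only
    omega

/-- The Pólya multiplier is nonzero. [folklore] -/
theorem linForm_pow_ne_zero (hN : 1 ≤ N) (a : ℝ≥0) (M : ℕ) : linForm N a ^ M ≠ 0 := by
  classical
  intro h0
  have h1 : eval (fun _ => (1 : ℝ≥0)) (linForm N a ^ M) = 0 := by rw [h0, map_zero]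
  rw [map_pow] at h1
  have hbase : eval (fun _ => (1 : ℝ≥0)) (linForm N a) ≠ 0 := by
    rw [linForm, map_add, eval_C, map_sum]
    simp only [eval_X, Finset.sum_const, Finset.card_univ, nsmul_eq_mul, mul_one]
    have hcard : (0 : ℝ≥0) < (Fintype.card (Fin N × Option (Fin N)) : ℝ≥0) := by
      have : 0 < Fintype.card (Fin N × Option (Fin N)) := by
        rw [Fintype.card_prod, Fintype.card_fin, Fintype.card_option, Fintype.card_fin]
        exact Nat.mul_pos (by omega) (by omega)
      exact_mod_cast this
    exact ne_of_gt (add_pos_of_nonneg_of_pos zero_le hcard)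
  exact pow_ne_zero M hbase h1

/-- **Pólya multipliers of any degree are useless for `ST`**: for `N ≥ 61`, every `a ≥ 0` and
EVERY exponent `M`, `2^{(N-1)/20} ≤ L_{ℝ≥0}(ST_N · (a + Σ_v x_v)^M) + 1`. [folklore] -/
theorem two_rpow_le_complexity_stPoly_mul_linPow (hN : 61 ≤ N) (a : ℝ≥0) (M : ℕ) :
    (2 : ℝ) ^ ((1 / 20 : ℝ) * (N - 1 : ℕ)) ≤ complexity (stPoly ℝ≥0 N * linForm N a ^ M) + 1 := by
  have h1 : 1 ≤ N := by omega
  have := two_rpow_le_complexity_stPoly_mul_of_rows (linForm_pow_ne_zero h1 a M) 2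
    {⟨N - 1, by omega⟩} (rows_topComponent_linPow h1 a M) (by simp; omega)
  simpa using this

/-! ### The Pólya strengthening of the crux is false -/


/-- **`ZeroOneTransfer` with PÓLYA cofactors is false.**  Restricting the cofactor of the crux
to powers `(1 + Σ_i x_i)^M` (any `M`, even uncharged degree) fails for `f = ST` (0/1 coefficients,
`VP_ℂ`): by `two_rpow_le_complexity_stPoly_mul_linPow`, `L(ST_N · (1 + Σ x)^M) + 1 ≥ 2^{(N-1)/20}`
for all `M`, which beats `2^{(log₂ N + c)^c}` at the `N` of `exists_qp_lt_forty c`.  Pólya's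
positivity certificates (multiply by a power of the sum of the variables) therefore cannot prove
the crux; cf. `zeroOneTransfer_lowDegreeCofactor_false` for all cofactors of degree `≤ deg f /2`.
[folklore] -/
theorem zeroOneTransfer_polya_false :
    ¬ (∀ (σ : ℕ → Type) [∀ n, Fintype (σ n)] (f : ∀ n, MvPolynomial (σ n) ℝ≥0),
        (∀ n m, MvPolynomial.coeff m (f n) = 0 ∨ MvPolynomial.coeff m (f n) = 1) →
        Literature.Computability.AlgebraicComplexity.IsVPFamily (k := ℂ)
          (fun n => MvPolynomial.map (Complex.ofRealHom.comp NNReal.toRealHom) (f n)) →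
        ∃ c : ℕ, ∀ n, ∃ M : ℕ,
          Literature.Computability.AlgebraicComplexity.complexity
              (f n * (1 + ∑ i : σ n, MvPolynomial.X i) ^ M) +
            Literature.Computability.AlgebraicComplexity.complexity
              ((1 + ∑ i : σ n, (MvPolynomial.X i : MvPolynomial (σ n) ℝ≥0)) ^ M) ≤
              2 ^ ((Nat.log 2 n + c) ^ c)) := by
  intro H
  have hmap : (fun N => map (Complex.ofRealHom.comp NNReal.toRealHom) (stPoly ℝ≥0 N)) =
      fun N => stPoly ℂ N := by
    funext N; exact map_stPoly _ N
  have hVP : IsVPFamily (k := ℂ)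
      (fun N => map (Complex.ofRealHom.comp NNReal.toRealHom) (stPoly ℝ≥0 N)) := by
    rw [hmap]; exact isVPFamily_stPoly_holds ℂ
  have h01 : ∀ (N : ℕ) (m : (Fin N × Option (Fin N)) →₀ ℕ),
      coeff m (stPoly ℝ≥0 N) = 0 ∨ coeff m (stPoly ℝ≥0 N) = 1 := by
    intro N m
    rw [coeff_stPoly]
    split_ifs <;> simp
  obtain ⟨c, hc⟩ := H (fun N => Fin N × Option (Fin N)) (fun N => stPoly ℝ≥0 N) h01 hVP
  obtain ⟨N, hN, hle⟩ := exists_qp_lt_forty c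
  obtain ⟨M, hbound⟩ := hc N
  have hlin : (1 + ∑ i : Fin N × Option (Fin N), (X i : MvPolynomial _ ℝ≥0)) = linForm N 1 := by
    rw [linForm, C_1]
  rw [hlin] at hbound
  have hlow := two_rpow_le_complexity_stPoly_mul_linPow (show 61 ≤ N by omega) 1 M
  generalize hE : (Nat.log 2 N + c) ^ c = E at hle hbound
  have hup : (complexity (stPoly ℝ≥0 N * linForm N 1 ^ M) : ℝ) + 1 ≤
      (2 : ℝ) ^ ((E + 1 : ℕ) : ℝ) := by
    rw [Real.rpow_natCast]
    have : complexity (stPoly ℝ≥0 N * linForm N 1 ^ M) + 1 ≤ 2 ^ (E + 1) := by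
      have := (Nat.le_add_right _ _).trans hbound
      have h1E : 1 ≤ 2 ^ E := Nat.one_le_two_pow
      rw [pow_succ]; omega
    exact_mod_cast this
  have h1 : (1 / 20 : ℝ) * (N - 1 : ℕ) ≤ ((E + 1 : ℕ) : ℝ) :=
    (Real.rpow_le_rpow_left_iff one_lt_two).mp (hlow.trans hup)
  have h2 : ((N - 1 : ℕ) : ℝ) ≤ 20 * ((E + 1 : ℕ) : ℝ) := by linarith
  have h3 : N - 1 ≤ 20 * (E + 1) := by exact_mod_cast h2
  omega


end Polya

/-- The Pólya strengthening IS a strengthening: it implies the crux (`h := (1 + Σ x)^M ≠ 0`,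
nonvanishing at the all-ones point). [folklore] -/
theorem zeroOneTransfer_of_polya
    (H : ∀ (σ : ℕ → Type) [∀ n, Fintype (σ n)] (f : ∀ n, MvPolynomial (σ n) ℝ≥0),
        (∀ n m, MvPolynomial.coeff m (f n) = 0 ∨ MvPolynomial.coeff m (f n) = 1) →
        Literature.Computability.AlgebraicComplexity.IsVPFamily (k := ℂ)
          (fun n => MvPolynomial.map (Complex.ofRealHom.comp NNReal.toRealHom) (f n)) →
        ∃ c : ℕ, ∀ n, ∃ M : ℕ,
          Literature.Computability.AlgebraicComplexity.complexity
              (f n * (1 + ∑ i : σ n, MvPolynomial.X i) ^ M) +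
            Literature.Computability.AlgebraicComplexity.complexity
              ((1 + ∑ i : σ n, (MvPolynomial.X i : MvPolynomial (σ n) ℝ≥0)) ^ M) ≤
              2 ^ ((Nat.log 2 n + c) ^ c)) : ZeroOneTransfer := by
  intro σ _ f h01 hVP
  obtain ⟨c, hc⟩ := H σ f h01 hVP
  refine ⟨c, fun n => ?_⟩
  obtain ⟨M, hM⟩ := hc n
  refine ⟨(1 + ∑ i : σ n, (X i : MvPolynomial (σ n) ℝ≥0)) ^ M, ?_, hM⟩
  apply pow_ne_zero
  intro h0
  have := congrArg (eval fun _ => (1 : ℝ≥0)) h0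
  rw [map_add, map_one, map_sum, map_zero] at this
  simp only [eval_X, Finset.sum_const] at this
  exact absurd this (ne_of_gt (add_pos_of_pos_of_nonneg one_pos zero_le))

end PolyaE

/-! ### (G) Exchange connectivity of arborescences: a necessary condition for positive
`ST`-projections; a face of `ST_2`, the permanent, dimer sums and `ST ⊕ ST` are not positive
`ST`-projections (cycle 2)

Landing as `Negative/Exchange.lean` + `ExchangeFace.lean` + `ExchangePerDimer.lean` + `ExchangeSum.lean`. -/

section ExchangeG

open Summit.ValiantsHypothesis.ValiantsHypothesis.Theorems.ZeroOneTransfer.Negative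
  (isArborescence_iff_exists_rank topComponent coeff_topComponent)

variable {N : ℕ}

/-! ### Descendants and ranks -/

/-- `a` is a `t`-descendant of `i`: iterating the parent map from `a` reaches `i` (`a = i`
included). [folklore] -/
def IsDesc (t : Fin N → Option (Fin N)) (i a : Fin N) : Prop :=
  ∃ k, (parentMap t)^[k] (some a) = some i

/-- Every node is its own descendant. [folklore] -/
theorem isDesc_refl (t : Fin N → Option (Fin N)) (i : Fin N) : IsDesc t i i := ⟨0, rfl⟩

/-- The root stays the root under iteration. [folklore] -/
theorem iterate_parentMap_none (t : Fin N → Option (Fin N)) (k : ℕ) :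
    (parentMap t)^[k] none = none :=
  Function.iterate_fixed (parentMap_none t) k

/-- A child of a descendant is a descendant. [folklore] -/
theorem isDesc_of_parent {t : Fin N → Option (Fin N)} {i a b : Fin N} (hab : t a = some b)
    (hb : IsDesc t i b) : IsDesc t i a := by
  obtain ⟨k, hk⟩ := hb
  exact ⟨k + 1, by rw [Function.iterate_succ_apply, parentMap_some, hab, hk]⟩

/-- The parent of a proper descendant is a descendant. [folklore] -/
theorem isDesc_parent {t : Fin N → Option (Fin N)} {i a : Fin N} (ha : IsDesc t i a) (hne : a ≠ i) :
    ∃ b, t a = some b ∧ IsDesc t i b := by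
  obtain ⟨k, hk⟩ := ha
  cases k with
  | zero => exact absurd (Option.some_injective _ hk) hne
  | succ k =>
    rw [Function.iterate_succ_apply, parentMap_some] at hk
    cases hta : t a with
    | none => rw [hta, iterate_parentMap_none] at hk; exact absurd hk (by simp)
    | some b => exact ⟨b, rfl, k, by rw [← hta]; exact hk⟩

/-- Ranks drop by at least the number of steps along parent chains. [folklore] -/
theorem rank_add_le_of_iterate {t : Fin N → Option (Fin N)} {rk : Fin N → ℕ}
    (hrk : ∀ i j, t i = some j → rk j < rk i) :
    ∀ (k : ℕ) (a b : Fin N), (parentMap t)^[k] (some a) = some b → rk b + k ≤ rk a := by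
  intro k
  induction k with
  | zero => intro a b h; have := Option.some_injective _ h; subst this; simp
  | succ k ih =>
    intro a b h
    rw [Function.iterate_succ_apply, parentMap_some] at h
    cases hta : t a with
    | none => rw [hta, iterate_parentMap_none] at h; exact absurd h (by simp)
    | some a' =>
      rw [hta] at h
      have h1 := ih a' b h
      have h2 := hrk a a' hta
      omega

/-- Intermediate points of a parent chain ending at a node are nodes. [folklore] -/
theorem exists_iterate_eq_some {t : Fin N → Option (Fin N)} {k : ℕ} {a i : Fin N}
    (hk : (parentMap t)^[k] (some a) = some i) {m : ℕ} (hm : m ≤ k) :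
    ∃ b, (parentMap t)^[m] (some a) = some b ∧ (parentMap t)^[k - m] (some b) = some i := by
  cases h : (parentMap t)^[m] (some a) with
  | none =>
    have : (parentMap t)^[k - m + m] (some a) = none := by
      rw [Function.iterate_add_apply, h, iterate_parentMap_none]
    rw [Nat.sub_add_cancel hm, hk] at this
    exact absurd this (by simp)
  | some b =>
    refine ⟨b, rfl, ?_⟩
    have : (parentMap t)^[k - m + m] (some a) = some i := by rw [Nat.sub_add_cancel hm, hk]
    rwa [Function.iterate_add_apply, h] at this

/-! ### The single-exchange lemma -/

/-- **Single exchange.**  For distinct arborescences `t ≠ t'` some differing node `i` can be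
re-hung onto its `t'`-parent: `update t i (t' i)` is an arborescence.  Proof: take a differing
node `i` of maximal `t`-rank.  If its `t'`-parent `w` were a `t`-descendant of `i`, all nodes on
the `t`-path from `w` up to `i` would have larger rank, hence agree in `t` and `t'`, and `t'`
would contain the cycle `i → w → ⋯ → i`.  So `w` is not below `i`, and shifting the ranks of the
subtree of `i` above everything ranks the new map. [folklore] -/
theorem exists_exchange {t t' : Fin N → Option (Fin N)} (ht : IsArborescence t)
    (ht' : IsArborescence t') (hne : t ≠ t') :
    ∃ i, t i ≠ t' i ∧ IsArborescence (Function.update t i (t' i)) := by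
  classical
  obtain ⟨rk, hrk⟩ := (isArborescence_iff_exists_rank t).1 ht
  obtain ⟨rk', hrk'⟩ := (isArborescence_iff_exists_rank t').1 ht'
  set D := Finset.univ.filter (fun i => t i ≠ t' i) with hD
  have hDne : D.Nonempty := by
    by_contra h
    rw [Finset.not_nonempty_iff_eq_empty] at h
    apply hne
    funext i
    by_contra hi
    have : i ∈ D := by simp [hD, hi]
    rw [h] at this
    simp at this
  obtain ⟨i, hiD, himax⟩ := Finset.exists_max_image D rk hDne
  have hi : t i ≠ t' i := (Finset.mem_filter.1 hiD).2
  refine ⟨i, hi, ?_⟩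
  -- key: the `t'`-parent of `i` is not a `t`-descendant of `i`
  have hkey : ∀ w, t' i = some w → ¬ IsDesc t i w := by
    rintro w hw ⟨k, hk⟩
    have hpath : ∀ m, m ≤ k → (parentMap t')^[m] (some w) = (parentMap t)^[m] (some w) := by
      intro m
      induction m with
      | zero => intro; rfl
      | succ m ih =>
        intro hm
        obtain ⟨b, hb, hbi⟩ := exists_iterate_eq_some hk (show m ≤ k by omega)
        rw [Function.iterate_succ_apply', Function.iterate_succ_apply', ih (by omega), hb,
          parentMap_some, parentMap_some]
        -- `b` is a proper descendant of `i`: its rank is larger, so it is not a differing node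
        have h1 := rank_add_le_of_iterate hrk (k - m) b i hbi
        have hbD : b ∉ D := fun hbD => by have := himax b hbD; omega
        have hbb : t b = t' b := by
          by_contra h
          exact hbD (by simp [hD, h])
        rw [hbb]
    have hk' : (parentMap t')^[k] (some w) = some i := by rw [hpath k le_rfl, hk]
    have h1 := rank_add_le_of_iterate hrk' k w i hk'
    have h2 := hrk' i w hw
    omega
  rw [isArborescence_iff_exists_rank]
  cases hti : t' i with
  | none =>
    refine ⟨rk, fun a b hab => ?_⟩
    by_cases hai : a = i
    · subst hai; rw [Function.update_self] at hab; cases hab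
    · rw [Function.update_of_ne hai] at hab; exact hrk a b hab
  | some w =>
    have hw : ¬ IsDesc t i w := hkey w hti
    refine ⟨fun a => if IsDesc t i a then rk a + (rk w + 1) else rk a, fun a b hab => ?_⟩
    by_cases hai : a = i
    · subst hai
      rw [Function.update_self] at hab
      cases hab
      simp only [if_pos (isDesc_refl t a), if_neg hw]
      omega
    · rw [Function.update_of_ne hai] at hab
      by_cases ha : IsDesc t i a
      · -- `b`, the `t`-parent of the proper descendant `a`, is a descendant too
        obtain ⟨b', hb', hb'd⟩ := isDesc_parent ha hai
        rw [hab] at hb'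
        cases hb'
        simp only [if_pos ha, if_pos hb'd]
        have := hrk a b hab
        omega
      · have hb : ¬ IsDesc t i b := fun hb => ha (isDesc_of_parent hab hb)
        simp only [if_neg ha, if_neg hb]
        exact hrk a b hab

/-- **Exchange connectivity (induction principle).**  A property of parent maps that holds at
the arborescence `t` and is preserved by single exchanges towards `t'` (among arborescences whose
every pointer is a `t`- or a `t'`-pointer) holds at the arborescence `t'`. [folklore] -/
theorem arborescence_chain_induction {t t' : Fin N → Option (Fin N)} (ht : IsArborescence t)
    (ht' : IsArborescence t') (P : (Fin N → Option (Fin N)) → Prop) (h0 : P t)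
    (hstep : ∀ (s : Fin N → Option (Fin N)) (i : Fin N), IsArborescence s →
      (∀ j, s j = t j ∨ s j = t' j) → P s → IsArborescence (Function.update s i (t' i)) →
      P (Function.update s i (t' i))) :
    P t' := by
  classical
  -- induction on the number of nodes where `s` differs from `t'`
  suffices H : ∀ (n : ℕ) (s : Fin N → Option (Fin N)), IsArborescence s →
      (∀ j, s j = t j ∨ s j = t' j) → P s →
      (Finset.univ.filter fun j => s j ≠ t' j).card ≤ n → P t' by
    exact H _ t ht (fun j => Or.inl rfl) h0 le_rfl
  intro n
  induction n with
  | zero =>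
    intro s _ _ hP hcard
    have hst : s = t' := by
      funext j
      by_contra hj
      have : j ∈ Finset.univ.filter (fun j => s j ≠ t' j) := by simp [hj]
      rw [Finset.card_eq_zero.mp (Nat.le_zero.mp hcard)] at this
      simp at this
    rwa [hst] at hP
  | succ n ih =>
    intro s hs hst hP hcard
    by_cases heq : s = t'
    · rwa [heq] at hP
    obtain ⟨i, hi, hs'⟩ := exists_exchange hs ht' heq
    refine ih (Function.update s i (t' i)) hs' ?_ (hstep s i hs hst hP hs') ?_
    · intro j
      by_cases hji : j = i
      · subst hji; right; exact Function.update_self _ _ _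
      · rw [Function.update_of_ne hji]; exact hst j
    · -- the differing set strictly shrinks
      have hsub : (Finset.univ.filter fun j => Function.update s i (t' i) j ≠ t' j) ⊂
          Finset.univ.filter fun j => s j ≠ t' j := by
        rw [Finset.ssubset_iff_of_subset]
        · refine ⟨i, by simp [hi], ?_⟩
          simp
        · intro j hj
          simp only [Finset.mem_filter, Finset.mem_univ, true_and] at hj ⊢
          by_cases hji : j = i
          · subst hji; simp at hj
          · rwa [Function.update_of_ne hji] at hj
      have := Finset.card_lt_card hsub
      omega


/-! ### Positive projections of `ST_N`: labels, exponents, constants -/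

section PosSubst

variable {τ : Type*}

/-- The exponent carried by a label (a variable `j ↦ e_j`, a constant `↦ 0`). [folklore] -/
def lexp (l : τ ⊕ ℝ≥0) : τ →₀ ℕ := Sum.elim (fun j => Finsupp.single j 1) (fun _ => 0) l

/-- The scalar carried by a label (a variable `↦ 1`, a constant `r ↦ r`). [folklore] -/
def lcst (l : τ ⊕ ℝ≥0) : ℝ≥0 := Sum.elim (fun _ => 1) id l

/-- A label is a variable or a constant: `X j = C 1 · x^{e_j}`, `C r = C r · x^0`. [folklore] -/
theorem labelPoly_eq (l : τ ⊕ ℝ≥0) :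
    (Sum.elim X C l : MvPolynomial τ ℝ≥0) = monomial (lexp l) (lcst l) := by
  cases l with
  | inl j => simp only [Sum.elim_inl, lexp, lcst]; rfl
  | inr r => simp only [Sum.elim_inr, lexp, lcst, id]; rfl

/-- The possible exponents of a label. [folklore] -/
theorem lexp_cases (l : τ ⊕ ℝ≥0) : lexp l = 0 ∨ ∃ j, lexp l = Finsupp.single j 1 := by
  cases l with
  | inl j => exact Or.inr ⟨j, rfl⟩
  | inr r => exact Or.inl rfl

/-- The exponent vector of the term of the parent map `t` under the labelling `ℓ`. [folklore] -/
def vexp (ℓ : Fin N × Option (Fin N) → τ ⊕ ℝ≥0) (t : Fin N → Option (Fin N)) : τ →₀ ℕ :=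
  ∑ i : Fin N, lexp (ℓ (i, t i))

/-- The scalar of the term of the parent map `t` under the labelling `ℓ`. [folklore] -/
def cst (ℓ : Fin N × Option (Fin N) → τ ⊕ ℝ≥0) (t : Fin N → Option (Fin N)) : ℝ≥0 :=
  ∏ i : Fin N, lcst (ℓ (i, t i))

/-- The term of `t` under a positive substitution is the monomial `cst · x^{vexp}`. [folklore] -/
theorem prod_label_eq (ℓ : Fin N × Option (Fin N) → τ ⊕ ℝ≥0) (t : Fin N → Option (Fin N)) :
    ∏ i : Fin N, (Sum.elim X C (ℓ (i, t i)) : MvPolynomial τ ℝ≥0) =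
      monomial (vexp ℓ t) (cst ℓ t) := by
  classical
  simp_rw [labelPoly_eq]
  rw [vexp, cst]
  induction (Finset.univ : Finset (Fin N)) using Finset.induction_on with
  | empty => simp
  | insert a s has ih => rw [Finset.prod_insert has, Finset.sum_insert has, Finset.prod_insert has,
      ih, monomial_mul]

/-- **A positive projection of `ST_N` as a sum of monomials over arborescences.** [folklore] -/
theorem aeval_stPoly_label (ℓ : Fin N × Option (Fin N) → τ ⊕ ℝ≥0) :
    aeval (fun v => (Sum.elim X C (ℓ v) : MvPolynomial τ ℝ≥0)) (stPoly ℝ≥0 N) =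
      ∑ t ∈ arborescences N, monomial (vexp ℓ t) (cst ℓ t) := by
  classical
  rw [stPoly_eq_sum_monomial, map_sum]
  refine Finset.sum_congr rfl fun t _ => ?_
  rw [← prod_X_arb_eq_monomial, map_prod]
  simp only [aeval_X]
  exact prod_label_eq ℓ t

/-- Coefficients of a positive projection of `ST_N`. [folklore] -/
theorem coeff_aeval_stPoly_label [DecidableEq τ] (ℓ : Fin N × Option (Fin N) → τ ⊕ ℝ≥0)
    (γ : τ →₀ ℕ) :
    coeff γ (aeval (fun v => (Sum.elim X C (ℓ v) : MvPolynomial τ ℝ≥0)) (stPoly ℝ≥0 N)) =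
      ∑ t ∈ arborescences N, if vexp ℓ t = γ then cst ℓ t else 0 := by
  classical
  rw [aeval_stPoly_label, coeff_sum]
  simp only [coeff_monomial]

/-- A surviving arborescence puts its exponent into the support (no cancellation over `ℝ≥0`).
[folklore] -/
theorem cst_le_coeff_aeval_stPoly (ℓ : Fin N × Option (Fin N) → τ ⊕ ℝ≥0)
    {t : Fin N → Option (Fin N)} (ht : IsArborescence t) :
    cst ℓ t ≤ coeff (vexp ℓ t) (aeval (fun v => (Sum.elim X C (ℓ v) : MvPolynomial τ ℝ≥0))
      (stPoly ℝ≥0 N)) := by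
  classical
  rw [coeff_aeval_stPoly_label]
  have := Finset.single_le_sum (f := fun s => if vexp ℓ s = vexp ℓ t then cst ℓ s else 0)
    (fun _ _ => zero_le) (mem_arborescences.mpr ht)
  simpa using this

/-- Conversely every monomial of a positive projection of `ST_N` comes from a surviving
arborescence. [folklore] -/
theorem exists_arborescence_of_coeff_ne_zero (ℓ : Fin N × Option (Fin N) → τ ⊕ ℝ≥0)
    {γ : τ →₀ ℕ}
    (h : coeff γ (aeval (fun v => (Sum.elim X C (ℓ v) : MvPolynomial τ ℝ≥0)) (stPoly ℝ≥0 N)) ≠ 0) :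
    ∃ t, IsArborescence t ∧ vexp ℓ t = γ ∧ cst ℓ t ≠ 0 := by
  classical
  rw [coeff_aeval_stPoly_label] at h
  obtain ⟨t, ht, hne⟩ := Finset.exists_ne_zero_of_sum_ne_zero h
  refine ⟨t, mem_arborescences.mp ht, ?_⟩
  split_ifs at hne with hv
  · exact ⟨hv, hne⟩
  · exact absurd rfl hne

/-- **One exchange moves the exponent by one label**:
`vexp (update s i x) + lexp (ℓ (i, s i)) = vexp s + lexp (ℓ (i, x))`. [folklore] -/
theorem vexp_update (ℓ : Fin N × Option (Fin N) → τ ⊕ ℝ≥0) (s : Fin N → Option (Fin N))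
    (i : Fin N) (x : Option (Fin N)) :
    vexp ℓ (Function.update s i x) + lexp (ℓ (i, s i)) = vexp ℓ s + lexp (ℓ (i, x)) := by
  classical
  unfold vexp
  have h1 : ∑ j, lexp (ℓ (j, Function.update s i x j)) =
      lexp (ℓ (i, x)) + ∑ j ∈ Finset.univ.erase i, lexp (ℓ (j, s j)) := by
    rw [← Finset.add_sum_erase _ _ (Finset.mem_univ i), Function.update_self]
    congr 1
    exact Finset.sum_congr rfl fun j hj => by rw [Function.update_of_ne (Finset.ne_of_mem_erase hj)]
  have h2 : ∑ j, lexp (ℓ (j, s j)) = lexp (ℓ (i, s i)) + ∑ j ∈ Finset.univ.erase i, lexp (ℓ (j, s j)) := by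
    rw [← Finset.add_sum_erase _ _ (Finset.mem_univ i)]
  rw [h1, h2]
  abel

/-- Parent maps built from pointers of two surviving maps survive. [folklore] -/
theorem cst_ne_zero_of_pointers (ℓ : Fin N × Option (Fin N) → τ ⊕ ℝ≥0)
    {t t' s : Fin N → Option (Fin N)} (ht : cst ℓ t ≠ 0) (ht' : cst ℓ t' ≠ 0)
    (hs : ∀ j, s j = t j ∨ s j = t' j) : cst ℓ s ≠ 0 := by
  unfold cst at *
  rw [Finset.prod_ne_zero_iff] at *
  intro j hj
  rcases hs j with h | h <;> rw [h]
  exacts [ht j hj, ht' j hj]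

/-- The arithmetic core: `e_c + e_d + p₁ = e_a + e_b + p₂` is impossible for `c, d ∉ {a, b}`,
`c ≠ d` and `p₂ ∈ {0} ∪ {e_j}`. [folklore] -/
theorem single_add_single_ne {a b c d : τ} (hca : c ≠ a) (hcb : c ≠ b) (hda : d ≠ a)
    (hdb : d ≠ b) (hcd : c ≠ d) {p₁ p₂ : τ →₀ ℕ} (hp₂ : p₂ = 0 ∨ ∃ j, p₂ = Finsupp.single j 1)
    (h : Finsupp.single c 1 + Finsupp.single d 1 + p₁ = Finsupp.single a 1 + Finsupp.single b 1 + p₂) :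
    False := by
  classical
  have hc := congrArg (fun f => f c) h
  have hd := congrArg (fun f => f d) h
  simp only [Finsupp.add_apply, Finsupp.single_eq_same, Finsupp.single_eq_of_ne hcd.symm,
    Finsupp.single_eq_of_ne hcd, Finsupp.single_eq_of_ne hca, Finsupp.single_eq_of_ne hcb,
    Finsupp.single_eq_of_ne hda, Finsupp.single_eq_of_ne hdb] at hc hd
  rcases hp₂ with rfl | ⟨j, rfl⟩
  · simp at hc
  · by_cases hjc : j = c
    · rw [hjc, Finsupp.single_eq_of_ne hcd.symm] at hd
      omega
    · rw [Finsupp.single_eq_of_ne (Ne.symm hjc)] at hc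
      omega

/-- **`x_a x_b + x_c x_d` is not a positive projection of any `ST_N`** (`c, d ∉ {a, b}`, `c ≠ d`):
an arborescence realising `x_a x_b` and one realising `x_c x_d` are joined by an exchange chain
of surviving arborescences whose exponents all lie in the support `{e_a + e_b, e_c + e_d}` and
move by one label at a time (`vexp_update`) — but `e_c + e_d` is not one label away from
`e_a + e_b`. [folklore] -/
theorem not_posProj_XaXb_add_XcXd {a b c d : τ} (hca : c ≠ a) (hcb : c ≠ b) (hda : d ≠ a)
    (hdb : d ≠ b) (hcd : c ≠ d) :
    ¬ ∃ (N : ℕ) (e : Fin N × Option (Fin N) → MvPolynomial τ ℝ≥0),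
      (∀ v, (∃ j, e v = X j) ∨ ∃ r, e v = C r) ∧
      aeval e (stPoly ℝ≥0 N) = X a * X b + X c * X d := by
  classical
  rintro ⟨N, e, he, heq⟩
  -- labels
  obtain ⟨ℓ, rfl⟩ : ∃ ℓ : Fin N × Option (Fin N) → τ ⊕ ℝ≥0,
      e = fun v => (Sum.elim X C (ℓ v) : MvPolynomial τ ℝ≥0) := by
    refine ⟨fun v => if h : ∃ j, e v = X j then Sum.inl h.choose
      else Sum.inr ((he v).resolve_left h).choose, ?_⟩
    funext v
    by_cases h : ∃ j, e v = X j
    · simp only [dif_pos h, Sum.elim_inl]; exact h.choose_spec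
    · simp only [dif_neg h, Sum.elim_inr]; exact ((he v).resolve_left h).choose_spec
  -- the target polynomial and its two monomials
  set mab : τ →₀ ℕ := Finsupp.single a 1 + Finsupp.single b 1 with hmab
  set mcd : τ →₀ ℕ := Finsupp.single c 1 + Finsupp.single d 1 with hmcd
  have hP : (X a * X b + X c * X d : MvPolynomial τ ℝ≥0) = monomial mab 1 + monomial mcd 1 := by
    simp only [hmab, hmcd, X, monomial_mul, mul_one]
  have hne : mab ≠ mcd := by
    intro h
    have := congrArg (fun f => f c) h
    simp only [hmab, hmcd, Finsupp.add_apply, Finsupp.single_eq_same,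
      Finsupp.single_eq_of_ne hca, Finsupp.single_eq_of_ne hcb,
      Finsupp.single_eq_of_ne hcd] at this
    omega
  have hcoeff : ∀ γ, coeff γ (X a * X b + X c * X d : MvPolynomial τ ℝ≥0) =
      (if mab = γ then 1 else 0) + (if mcd = γ then 1 else 0) := by
    intro γ; rw [hP, coeff_add, coeff_monomial, coeff_monomial]
  have hab : coeff mab (X a * X b + X c * X d : MvPolynomial τ ℝ≥0) ≠ 0 := by
    rw [hcoeff, if_pos rfl]; exact ne_of_gt (add_pos_of_pos_of_nonneg one_pos zero_le)
  have hcd' : coeff mcd (X a * X b + X c * X d : MvPolynomial τ ℝ≥0) ≠ 0 := by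
    rw [hcoeff, if_pos rfl]; exact ne_of_gt (add_pos_of_nonneg_of_pos zero_le one_pos)
  have hsupp : ∀ γ, coeff γ (X a * X b + X c * X d : MvPolynomial τ ℝ≥0) ≠ 0 →
      γ = mab ∨ γ = mcd := by
    intro γ hγ
    rw [hcoeff] at hγ
    by_contra hno
    push Not at hno
    rw [if_neg (Ne.symm hno.1), if_neg (Ne.symm hno.2), add_zero] at hγ
    exact hγ rfl
  -- the two arborescences
  rw [← heq] at hab hcd' hsupp
  obtain ⟨t, ht, hvt, hct⟩ := exists_arborescence_of_coeff_ne_zero ℓ hab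
  obtain ⟨t', ht', hvt', hct'⟩ := exists_arborescence_of_coeff_ne_zero ℓ hcd'
  -- walk from `t` to `t'`: the exponent never leaves `mab`
  have key := arborescence_chain_induction ht ht' (fun s => vexp ℓ s = mab) hvt ?_
  · exact hne (key.symm.trans hvt')
  intro s i hs hsp hPs hs'
  have hsp' : ∀ j, Function.update s i (t' i) j = t j ∨ Function.update s i (t' i) j = t' j := by
    intro j
    by_cases hji : j = i
    · subst hji; right; exact Function.update_self _ _ _
    · rw [Function.update_of_ne hji]; exact hsp j
  have hcs' : cst ℓ (Function.update s i (t' i)) ≠ 0 := cst_ne_zero_of_pointers ℓ hct hct' hsp'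
  have hmem : coeff (vexp ℓ (Function.update s i (t' i)))
      (aeval (fun v => (Sum.elim X C (ℓ v) : MvPolynomial τ ℝ≥0)) (stPoly ℝ≥0 N)) ≠ 0 :=
    ne_of_gt (lt_of_lt_of_le (pos_iff_ne_zero.mpr hcs') (cst_le_coeff_aeval_stPoly ℓ hs'))
  rcases hsupp _ hmem with h | h
  · exact h
  · exfalso
    have hupd := vexp_update ℓ s i (t' i)
    rw [h, hPs] at hupd
    exact single_add_single_ne hca hcb hda hdb hcd (lexp_cases _) hupd

end PosSubst

/-! ### A two-term face of `ST_2` -/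

section Two

/-- The arborescences on two non-root nodes: the star and the two paths. [folklore] -/
theorem isArborescence_two_iff (t : Fin 2 → Option (Fin 2)) :
    IsArborescence t ↔ (t 0 = none ∧ t 1 = none) ∨ (t 0 = some 1 ∧ t 1 = none) ∨
      (t 0 = none ∧ t 1 = some 0) := by
  rw [isArborescence_iff_exists_rank]
  constructor
  · rintro ⟨rk, hrk⟩
    have h00 : t 0 ≠ some 0 := fun h => lt_irrefl _ (hrk 0 0 h)
    have h11 : t 1 ≠ some 1 := fun h => lt_irrefl _ (hrk 1 1 h)
    have hcyc : ¬ (t 0 = some 1 ∧ t 1 = some 0) := fun ⟨h1, h2⟩ => by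
      have := hrk 0 1 h1; have := hrk 1 0 h2; omega
    rcases h0 : t 0 with _ | j0 <;> rcases h1 : t 1 with _ | j1
    · exact Or.inl ⟨rfl, rfl⟩
    · right; right
      refine ⟨rfl, ?_⟩
      fin_cases j1
      · rfl
      · exact absurd h1 h11
    · right; left
      refine ⟨?_, rfl⟩
      fin_cases j0
      · exact absurd h0 h00
      · rfl
    · exfalso
      fin_cases j0
      · exact h00 h0
      · fin_cases j1
        · exact hcyc ⟨h0, h1⟩
        · exact h11 h1
  · rintro (⟨h0, h1⟩ | ⟨h0, h1⟩ | ⟨h0, h1⟩)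
    · refine ⟨fun _ => 0, fun i j hij => ?_⟩
      fin_cases i
      · simp [h0] at hij
      · simp [h1] at hij
    · refine ⟨fun i => if i = 0 then 1 else 0, fun i j hij => ?_⟩
      fin_cases i
      · simp only [h0, Fin.zero_eta, Option.some.injEq] at hij; subst hij; simp
      · simp [h1] at hij
    · refine ⟨fun i => if i = 1 then 1 else 0, fun i j hij => ?_⟩
      fin_cases i
      · simp [h0] at hij
      · simp only [h1, Fin.mk_one, Option.some.injEq] at hij; subst hij; simp

/-- The three arborescences on two non-root nodes, as parent maps. [folklore] -/
theorem arborescences_two : arborescences 2 =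
    {(![none, none] : Fin 2 → Option (Fin 2)), ![some 1, none], ![none, some 0]} := by
  ext t
  rw [mem_arborescences, isArborescence_two_iff]
  simp only [Finset.mem_insert, Finset.mem_singleton]
  have ht : ∀ (x y : Option (Fin 2)), (t 0 = x ∧ t 1 = y) ↔ t = ![x, y] := by
    intro x y
    constructor
    · rintro ⟨h0, h1⟩; funext i; fin_cases i <;> simp [h0, h1]
    · rintro rfl; simp
  rw [ht, ht, ht]

/-- **`ST_2` explicitly**: `x_{0r} x_{1r} + x_{01} x_{1r} + x_{0r} x_{10}`. [folklore] -/
theorem stPoly_two (R : Type*) [CommSemiring R] :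
    stPoly R 2 = X (0, none) * X (1, none) + X (0, some 1) * X (1, none) +
      X (0, none) * X (1, some 0) := by
  classical
  rw [stPoly_eq_sum_monomial, arborescences_two, Finset.sum_insert, Finset.sum_insert,
    Finset.sum_singleton]
  · simp only [← prod_X_arb_eq_monomial, Fin.prod_univ_two, Matrix.cons_val_zero,
      Matrix.cons_val_one]
    ring
  · simp only [Finset.mem_singleton]
    intro h
    have := congrFun h 0
    simp at this
  · simp only [Finset.mem_insert, Finset.mem_singleton, not_or]
    constructor
    · intro h; have := congrFun h 0; simp at this
    · intro h; have := congrFun h 1; simp at this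

/-- The weight selecting the two path trees: `1` on `x_{01}` and `x_{10}`, `0` elsewhere.
[folklore] -/
def faceWeight : Fin 2 × Option (Fin 2) → ℕ := fun v =>
  if v = (0, some 1) ∨ v = (1, some 0) then 1 else 0

/-- Top component of `q + r` when `r ≠ 0` is weighted homogeneous of degree above that of `q`.
[folklore] -/
theorem topComponent_add_eq_right {σ : Type*} (w : σ → ℕ) {q r : MvPolynomial σ ℝ≥0} {n : ℕ}
    (hr : IsWeightedHomogeneous w r n) (hr0 : r ≠ 0)
    (hq : ∀ d ∈ q.support, Finsupp.weight w d < n) : topComponent w (q + r) = r := by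
  classical
  -- the weighted degree of `q + r` is `n`
  have hdeg : weightedTotalDegree w (q + r) = n := by
    apply le_antisymm
    · refine Finset.sup_le fun d hd => ?_
      rcases Finset.mem_union.1 (support_add hd) with h | h
      · exact (hq d h).le
      · exact (hr (mem_support_iff.mp h)).le
    · obtain ⟨d, hd⟩ := exists_coeff_ne_zero hr0
      have hdn : Finsupp.weight w d = n := hr hd
      have hdq : coeff d q = 0 := by
        by_contra h
        exact absurd hdn (ne_of_lt (hq d (mem_support_iff.mpr h)))
      have hmem : d ∈ (q + r).support := by
        rw [mem_support_iff, coeff_add, hdq, zero_add]; exact hd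
      exact hdn ▸ le_weightedTotalDegree w hmem
  refine MvPolynomial.ext _ _ fun d => ?_
  rw [coeff_topComponent, hdeg, coeff_add]
  split_ifs with h
  · have hdq : coeff d q = 0 := by
      by_contra h'
      exact absurd h (ne_of_lt (hq d (mem_support_iff.mpr h')))
    rw [hdq, zero_add]
  · symm
    by_contra h'
    exact h (hr h')

/-- **A two-term face of `ST_2`**: the initial form of `ST_2` in direction `faceWeight` consists
of the two paths `x_{01} x_{1r} + x_{0r} x_{10}` (both use exactly one weighted edge; the star
uses none; both weighted edges together would be the 2-cycle). [folklore] -/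
theorem topComponent_stPoly_two :
    topComponent faceWeight (stPoly ℝ≥0 2) =
      X (0, some 1) * X (1, none) + X (0, none) * X (1, some 0) := by
  classical
  rw [stPoly_two, add_assoc]
  have hw1 : Finsupp.weight faceWeight
      (Finsupp.single ((0 : Fin 2), some (1 : Fin 2)) 1 + Finsupp.single ((1 : Fin 2), (none : Option (Fin 2))) 1) = 1 := by
    rw [map_add, Finsupp.weight_single, Finsupp.weight_single]; decide
  have hw2 : Finsupp.weight faceWeight
      (Finsupp.single ((0 : Fin 2), (none : Option (Fin 2))) 1 + Finsupp.single ((1 : Fin 2), some (0 : Fin 2)) 1) = 1 := by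
    rw [map_add, Finsupp.weight_single, Finsupp.weight_single]; decide
  have hw0 : Finsupp.weight faceWeight
      (Finsupp.single ((0 : Fin 2), (none : Option (Fin 2))) 1 + Finsupp.single ((1 : Fin 2), (none : Option (Fin 2))) 1) = 0 := by
    rw [map_add, Finsupp.weight_single, Finsupp.weight_single]; decide
  refine topComponent_add_eq_right faceWeight (n := 1) ?_ ?_ ?_
  · refine IsWeightedHomogeneous.add ?_ ?_
    · simp only [X, monomial_mul, mul_one]
      exact isWeightedHomogeneous_monomial _ _ _ hw1
    · simp only [X, monomial_mul, mul_one]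
      exact isWeightedHomogeneous_monomial _ _ _ hw2
  · -- `r ≠ 0`: its coefficient at the exponent of `x_{01} x_{1r}` is `1`
    intro h
    have hc : coeff (Finsupp.single ((0 : Fin 2), some (1 : Fin 2)) 1 +
        Finsupp.single ((1 : Fin 2), (none : Option (Fin 2))) 1)
        (X (0, some 1) * X (1, none) + X (0, none) * X (1, some 0) :
          MvPolynomial (Fin 2 × Option (Fin 2)) ℝ≥0) = 1 := by
      simp only [X, monomial_mul, mul_one, coeff_add, coeff_monomial, if_true]
      rw [if_neg, add_zero]
      intro h'
      have := congrArg (fun f : (Fin 2 × Option (Fin 2)) →₀ ℕ => f ((0 : Fin 2), some (1 : Fin 2))) h'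
      simp at this
    rw [h, coeff_zero] at hc
    exact zero_ne_one hc
  · intro d hd
    simp only [X, monomial_mul, mul_one] at hd
    have hd' : d = Finsupp.single ((0 : Fin 2), (none : Option (Fin 2))) 1 +
        Finsupp.single ((1 : Fin 2), (none : Option (Fin 2))) 1 := by
      have := support_monomial_subset hd
      simpa using this
    rw [hd', hw0]; exact one_pos

/-- **Positive `ST`-projections are not closed under initial forms**: the face
`top_{faceWeight}(ST_2) = x_{01} x_{1r} + x_{0r} x_{10}` of `ST_2` is not a positive projection of
any `ST_N`.  (It is of course a SUM of two such projections.) [folklore] -/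
theorem face_of_stPoly_two_not_posProj :
    ¬ ∃ (N : ℕ) (e : Fin N × Option (Fin N) → MvPolynomial (Fin 2 × Option (Fin 2)) ℝ≥0),
      (∀ v, (∃ j, e v = X j) ∨ ∃ r, e v = C r) ∧
      aeval e (stPoly ℝ≥0 N) = topComponent faceWeight (stPoly ℝ≥0 2) := by
  rw [topComponent_stPoly_two]
  exact not_posProj_XaXb_add_XcXd (a := ((0 : Fin 2), some (1 : Fin 2)))
    (b := ((1 : Fin 2), (none : Option (Fin 2)))) (c := ((0 : Fin 2), (none : Option (Fin 2))))
    (d := ((1 : Fin 2), some (0 : Fin 2))) (by simp) (by simp) (by simp) (by simp) (by simp)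

end Two

/-! ### The permanent is not a positive projection of any `ST_N` -/

section Per

variable {n : ℕ}

/-- The exponent vector of the permutation monomial `Π_i x_{ρ i, i}`. [folklore] -/
def perExp (ρ : Equiv.Perm (Fin n)) : (Fin n × Fin n) →₀ ℕ :=
  ∑ i : Fin n, Finsupp.single (ρ i, i) 1

/-- Entries of the permutation exponent: `1` at `(ρ b, b)`, else `0`. [folklore] -/
theorem perExp_apply (ρ : Equiv.Perm (Fin n)) (a b : Fin n) :
    perExp ρ (a, b) = if ρ b = a then 1 else 0 := by
  classical
  unfold perExp
  rw [Finsupp.coe_finsetSum, Finset.sum_apply, Finset.sum_eq_single b]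
  · by_cases h : ρ b = a
    · simp [h]
    · rw [if_neg h, Finsupp.single_apply, if_neg]
      intro hab; exact h (Prod.ext_iff.mp hab).1
  · intro i _ hi
    rw [Finsupp.single_apply, if_neg]
    intro hab; exact hi (Prod.ext_iff.mp hab).2
  · intro hb; exact absurd (Finset.mem_univ b) hb

/-- The permanent over `ℝ≥0` as the sum of its permutation monomials. [folklore] -/
theorem perPoly_eq_sum_monomial (n : ℕ) :
    perPoly (Fin n) ℝ≥0 = ∑ ρ : Equiv.Perm (Fin n), monomial (perExp ρ) (1 : ℝ≥0) := by
  unfold perPoly Matrix.permanent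
  refine Finset.sum_congr rfl fun ρ _ => ?_
  rw [perExp, monomial_sum_one]
  refine Finset.prod_congr rfl fun i _ => ?_
  rw [Matrix.mvPolynomialX_apply, MvPolynomial.X]

/-- **Distinct permutation monomials are at least two labels apart**: `perExp ρ + p₁ =
perExp ρ₁ + p₂` with `p₂ ∈ {0} ∪ {e_j}` forces `ρ = ρ₁`. [folklore] -/
theorem perExp_eq_of_add_label {ρ ρ₁ : Equiv.Perm (Fin n)} {p₁ p₂ : (Fin n × Fin n) →₀ ℕ}
    (hp₂ : p₂ = 0 ∨ ∃ j, p₂ = Finsupp.single j 1) (h : perExp ρ + p₁ = perExp ρ₁ + p₂) :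
    ρ = ρ₁ := by
  classical
  by_contra hne
  obtain ⟨i, hi⟩ : ∃ i, ρ i ≠ ρ₁ i := by
    by_contra hall
    push Not at hall
    exact hne (Equiv.ext hall)
  -- a second differing position
  set j := ρ₁.symm (ρ i) with hj
  have hj1 : ρ₁ j = ρ i := by rw [hj, Equiv.apply_symm_apply]
  have hji : j ≠ i := by
    intro hji; rw [hji] at hj1; exact hi hj1.symm
  have hj2 : ρ j ≠ ρ₁ j := by
    intro h2
    rw [hj1] at h2
    exact hji (ρ.injective h2)
  have hci := congrArg (fun f => f (ρ i, i)) h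
  have hcj := congrArg (fun f => f (ρ j, j)) h
  simp only [Finsupp.add_apply, perExp_apply, if_true, if_neg (Ne.symm hi),
    if_neg (Ne.symm hj2)] at hci hcj
  rcases hp₂ with rfl | ⟨j', rfl⟩
  · simp at hci
  · by_cases hj' : j' = (ρ i, i)
    · rw [hj', Finsupp.single_eq_of_ne] at hcj
      · omega
      · intro heq
        simp only [Prod.mk.injEq] at heq
        exact hji heq.2
    · rw [Finsupp.single_eq_of_ne (Ne.symm hj')] at hci
      omega

/-- **The permanent `per_n`, `n ≥ 2`, is not a positive projection of any spanning-tree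
polynomial `ST_N`** (any `N`): its monomials are pairwise at least two labels apart, while the
support of a positive `ST`-projection is connected under one-label moves.  (So the trivial road
to an inconsistency of the route — `per` a positive projection of the division-easy `ST` — is
closed; consistent with H1.) [folklore] -/
theorem perPoly_not_posProj_stPoly (hn : 2 ≤ n) :
    ¬ ∃ (N : ℕ) (e : Fin N × Option (Fin N) → MvPolynomial (Fin n × Fin n) ℝ≥0),
      (∀ v, (∃ j, e v = X j) ∨ ∃ r, e v = C r) ∧
      aeval e (stPoly ℝ≥0 N) = perPoly (Fin n) ℝ≥0 := by
  classical
  rintro ⟨N, e, he, heq⟩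
  obtain ⟨ℓ, rfl⟩ : ∃ ℓ : Fin N × Option (Fin N) → (Fin n × Fin n) ⊕ ℝ≥0,
      e = fun v => (Sum.elim X C (ℓ v) : MvPolynomial (Fin n × Fin n) ℝ≥0) := by
    refine ⟨fun v => if h : ∃ j, e v = X j then Sum.inl h.choose
      else Sum.inr ((he v).resolve_left h).choose, ?_⟩
    funext v
    by_cases h : ∃ j, e v = X j
    · simp only [dif_pos h, Sum.elim_inl]; exact h.choose_spec
    · simp only [dif_neg h, Sum.elim_inr]; exact ((he v).resolve_left h).choose_spec
  -- coefficients of the permanent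
  have hcoeff : ∀ γ, coeff γ (perPoly (Fin n) ℝ≥0) =
      ∑ ρ : Equiv.Perm (Fin n), if perExp ρ = γ then (1 : ℝ≥0) else 0 := by
    intro γ; rw [perPoly_eq_sum_monomial, coeff_sum]; simp only [coeff_monomial]
  have hpos : ∀ ρ : Equiv.Perm (Fin n), coeff (perExp ρ) (perPoly (Fin n) ℝ≥0) ≠ 0 := by
    intro ρ
    rw [hcoeff]
    have := Finset.single_le_sum (f := fun ρ' : Equiv.Perm (Fin n) =>
      if perExp ρ' = perExp ρ then (1 : ℝ≥0) else 0) (fun _ _ => zero_le) (Finset.mem_univ ρ)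
    simp only [if_true] at this
    exact ne_of_gt (lt_of_lt_of_le one_pos this)
  have hsupp : ∀ γ, coeff γ (perPoly (Fin n) ℝ≥0) ≠ 0 → ∃ ρ, perExp ρ = γ := by
    intro γ hγ
    rw [hcoeff] at hγ
    obtain ⟨ρ, _, hρ⟩ := Finset.exists_ne_zero_of_sum_ne_zero hγ
    refine ⟨ρ, ?_⟩
    by_contra h
    exact hρ (if_neg h)
  -- two distinct permutations: the identity and the transposition of `0` and `1`
  set i0 : Fin n := ⟨0, by omega⟩
  set i1 : Fin n := ⟨1, by omega⟩
  have h01 : i0 ≠ i1 := by intro h; have := congrArg Fin.val h; simp [i0, i1] at this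
  set τ : Equiv.Perm (Fin n) := Equiv.swap i0 i1 with hτ
  have hτ1 : τ ≠ 1 := by
    intro h
    have := congrArg (fun σ : Equiv.Perm (Fin n) => σ i0) h
    simp only [hτ, Equiv.swap_apply_left, Equiv.Perm.coe_one, id_eq] at this
    exact h01 this.symm
  rw [← heq] at hpos hsupp
  obtain ⟨t, ht, hvt, hct⟩ := exists_arborescence_of_coeff_ne_zero ℓ (hpos 1)
  obtain ⟨t', ht', hvt', hct'⟩ := exists_arborescence_of_coeff_ne_zero ℓ (hpos τ)
  have key := arborescence_chain_induction ht ht' (fun s => vexp ℓ s = perExp 1) hvt ?_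
  · have h2 : perExp τ + 0 = perExp 1 + 0 := by rw [add_zero, add_zero, ← hvt', key]
    exact hτ1 (perExp_eq_of_add_label (Or.inl rfl) h2)
  intro s i hs hsp hPs hs'
  have hsp' : ∀ j, Function.update s i (t' i) j = t j ∨ Function.update s i (t' i) j = t' j := by
    intro j
    by_cases hji : j = i
    · subst hji; right; exact Function.update_self _ _ _
    · rw [Function.update_of_ne hji]; exact hsp j
  have hcs' : cst ℓ (Function.update s i (t' i)) ≠ 0 := cst_ne_zero_of_pointers ℓ hct hct' hsp'
  have hmem : coeff (vexp ℓ (Function.update s i (t' i)))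
      (aeval (fun v => (Sum.elim X C (ℓ v) : MvPolynomial (Fin n × Fin n) ℝ≥0)) (stPoly ℝ≥0 N)) ≠ 0 :=
    ne_of_gt (lt_of_lt_of_le (pos_iff_ne_zero.mpr hcs') (cst_le_coeff_aeval_stPoly ℓ hs'))
  obtain ⟨ρ, hρ⟩ := hsupp _ hmem
  have hupd := vexp_update ℓ s i (t' i)
  rw [← hρ, hPs] at hupd
  rw [← hρ, perExp_eq_of_add_label (lexp_cases _) hupd]

end Per

/-! ### The general obstruction: isolated supports; graph sums (dimers) -/

section Isolated

variable {τ : Type*}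

/-- **Split supports are not positive `ST`-projections.**  If the monomials of `P` split into a
class `U` and its complement, both inhabited, such that no monomial outside `U` is one label
away from a monomial in `U` (`β + p = α + q`, `q ∈ {0} ∪ {e_j}`, `α ∈ U` forces `β ∈ U`), then
`P` is not a positive projection of any `ST_N`: the support of a positive `ST`-projection is
connected under one-label moves (`arborescence_chain_induction`, `vexp_update`). [folklore] -/
theorem not_posProj_stPoly_of_split {P : MvPolynomial τ ℝ≥0} (U : (τ →₀ ℕ) → Prop)
    (hU : ∃ α, coeff α P ≠ 0 ∧ U α) (hV : ∃ β, coeff β P ≠ 0 ∧ ¬ U β)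
    (hsep : ∀ α β, coeff α P ≠ 0 → coeff β P ≠ 0 → U α → ∀ p q : τ →₀ ℕ,
      (p = 0 ∨ ∃ j, p = Finsupp.single j 1) → (q = 0 ∨ ∃ j, q = Finsupp.single j 1) →
      β + p = α + q → U β) :
    ¬ ∃ (N : ℕ) (e : Fin N × Option (Fin N) → MvPolynomial τ ℝ≥0),
      (∀ v, (∃ j, e v = X j) ∨ ∃ r, e v = C r) ∧ aeval e (stPoly ℝ≥0 N) = P := by
  classical
  rintro ⟨N, e, he, heq⟩
  obtain ⟨ℓ, rfl⟩ : ∃ ℓ : Fin N × Option (Fin N) → τ ⊕ ℝ≥0,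
      e = fun v => (Sum.elim X C (ℓ v) : MvPolynomial τ ℝ≥0) := by
    refine ⟨fun v => if h : ∃ j, e v = X j then Sum.inl h.choose
      else Sum.inr ((he v).resolve_left h).choose, ?_⟩
    funext v
    by_cases h : ∃ j, e v = X j
    · simp only [dif_pos h, Sum.elim_inl]; exact h.choose_spec
    · simp only [dif_neg h, Sum.elim_inr]; exact ((he v).resolve_left h).choose_spec
  obtain ⟨α, hα, hUα⟩ := hU
  obtain ⟨β, hβ, hVβ⟩ := hV
  rw [← heq] at hα hβ hsep
  obtain ⟨t, ht, hvt, hct⟩ := exists_arborescence_of_coeff_ne_zero ℓ hα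
  obtain ⟨t', ht', hvt', hct'⟩ := exists_arborescence_of_coeff_ne_zero ℓ hβ
  have key := arborescence_chain_induction ht ht'
    (fun s => coeff (vexp ℓ s) (aeval (fun v => (Sum.elim X C (ℓ v) : MvPolynomial τ ℝ≥0))
      (stPoly ℝ≥0 N)) ≠ 0 ∧ U (vexp ℓ s)) ⟨hvt.symm ▸ hα, hvt.symm ▸ hUα⟩ ?_
  · exact hVβ (hvt' ▸ key.2)
  intro s i hs hsp hPs hs'
  have hsp' : ∀ j, Function.update s i (t' i) j = t j ∨ Function.update s i (t' i) j = t' j := by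
    intro j
    by_cases hji : j = i
    · subst hji; right; exact Function.update_self _ _ _
    · rw [Function.update_of_ne hji]; exact hsp j
  have hcs' : cst ℓ (Function.update s i (t' i)) ≠ 0 := cst_ne_zero_of_pointers ℓ hct hct' hsp'
  have hmem : coeff (vexp ℓ (Function.update s i (t' i)))
      (aeval (fun v => (Sum.elim X C (ℓ v) : MvPolynomial τ ℝ≥0)) (stPoly ℝ≥0 N)) ≠ 0 :=
    ne_of_gt (lt_of_lt_of_le (pos_iff_ne_zero.mpr hcs') (cst_le_coeff_aeval_stPoly ℓ hs'))
  have hupd := vexp_update ℓ s i (t' i)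
  exact ⟨hmem, hsep _ _ hPs.1 hmem hPs.2 _ _ (lexp_cases _) (lexp_cases _) hupd⟩

/-- **Isolated supports are not positive `ST`-projections.**  If `P` has two distinct monomials
and no two distinct monomials of `P` are one label apart (`β + p = α + q` with
`q ∈ {0} ∪ {e_j}` forces `α = β`), then `P` is not a positive projection of any `ST_N`.
[folklore] -/
theorem not_posProj_stPoly_of_isolated {P : MvPolynomial τ ℝ≥0}
    (h2 : ∃ α β, α ≠ β ∧ coeff α P ≠ 0 ∧ coeff β P ≠ 0)
    (hiso : ∀ α β, coeff α P ≠ 0 → coeff β P ≠ 0 → ∀ p q : τ →₀ ℕ,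
      (q = 0 ∨ ∃ j, q = Finsupp.single j 1) → β + p = α + q → α = β) :
    ¬ ∃ (N : ℕ) (e : Fin N × Option (Fin N) → MvPolynomial τ ℝ≥0),
      (∀ v, (∃ j, e v = X j) ∨ ∃ r, e v = C r) ∧ aeval e (stPoly ℝ≥0 N) = P := by
  obtain ⟨α, β, hαβ, hα, hβ⟩ := h2
  exact not_posProj_stPoly_of_split (fun γ => γ = α) ⟨α, hα, rfl⟩ ⟨β, hβ, fun h => hαβ h.symm⟩
    fun α' β' hα' hβ' hU p q _ hq h => (hU ▸ (hiso α' β' hα' hβ' p q hq h).symm)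

/-- The exponent of the graph monomial `Π_v x_{(v, f v)}`. [folklore] -/
def gexp {α β : Type*} [Fintype α] (f : α → β) : (α × β) →₀ ℕ :=
  ∑ v : α, Finsupp.single (v, f v) 1

/-- Entries of the graph exponent. [folklore] -/
theorem gexp_apply {α β : Type*} [Fintype α] [DecidableEq α] [DecidableEq β] (f : α → β)
    (a : α) (b : β) : gexp f (a, b) = if f a = b then 1 else 0 := by
  unfold gexp
  rw [Finsupp.coe_finsetSum, Finset.sum_apply, Finset.sum_eq_single a]
  · by_cases h : f a = b
    · simp [h]
    · rw [if_neg h, Finsupp.single_apply, if_neg]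
      intro hab; exact h (Prod.ext_iff.mp hab).2
  · intro v _ hv
    rw [Finsupp.single_apply, if_neg]
    intro hab; exact hv (Prod.ext_iff.mp hab).1
  · intro ha; exact absurd (Finset.mem_univ a) ha

/-- **Maps differing at two points have graph exponents two labels apart**:
`gexp g + p = gexp f + q` with `q ∈ {0} ∪ {e_j}` and `f, g` differing at two distinct points is
impossible. [folklore] -/
theorem gexp_ne_of_two_diff {α β : Type*} [Fintype α] [DecidableEq α] [DecidableEq β]
    {f g : α → β} {u v : α} (huv : u ≠ v) (hu : f u ≠ g u) (hv : f v ≠ g v)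
    {p q : (α × β) →₀ ℕ} (hq : q = 0 ∨ ∃ j, q = Finsupp.single j 1)
    (h : gexp g + p = gexp f + q) : False := by
  classical
  have hcu := congrArg (fun e => e (u, g u)) h
  have hcv := congrArg (fun e => e (v, g v)) h
  simp only [Finsupp.add_apply, gexp_apply, if_true, if_neg hu, if_neg hv] at hcu hcv
  rcases hq with rfl | ⟨j, rfl⟩
  · simp at hcu
  · by_cases hj : j = (u, g u)
    · rw [hj, Finsupp.single_eq_of_ne] at hcv
      · omega
      · intro heq
        simp only [Prod.mk.injEq] at heq
        exact huv heq.1.symm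
    · rw [Finsupp.single_eq_of_ne (Ne.symm hj)] at hcu
      omega

/-- **Graph sums over pairwise two-apart families are not positive `ST`-projections.**  For a
finite family `S` of maps `α → β` with at least two members, any two of which differ at two
distinct points — perfect matchings / dimer covers encoded as fixed-point-free involutions
(the polynomials of cruxes `TriangularDimersDivisionEasy`, `SquareGridDimersDivisionEasy`),
permutations, … — the 0/1 polynomial `Σ_{f ∈ S} Π_v x_{(v, f v)}` is not a positive projection
of any `ST_N`.  (So Temperley/KPW-type identities "dimers = arborescences" are projections in
the opposite direction, or need the auxiliary factor / several summands of card
arborescence-span.) [folklore] -/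
theorem not_posProj_stPoly_graphSum {α β : Type*} [Fintype α] [DecidableEq α] [DecidableEq β]
    (S : Finset (α → β)) (h2 : ∃ f ∈ S, ∃ g ∈ S, f ≠ g)
    (hS : ∀ f ∈ S, ∀ g ∈ S, f ≠ g → ∃ u v, u ≠ v ∧ f u ≠ g u ∧ f v ≠ g v) :
    ¬ ∃ (N : ℕ) (e : Fin N × Option (Fin N) → MvPolynomial (α × β) ℝ≥0),
      (∀ v, (∃ j, e v = X j) ∨ ∃ r, e v = C r) ∧
      aeval e (stPoly ℝ≥0 N) = ∑ f ∈ S, ∏ v : α, (X (v, f v) : MvPolynomial (α × β) ℝ≥0) := by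
  classical
  -- the graph sum as a sum of monomials, and its coefficients
  have hsum : ∑ f ∈ S, ∏ v : α, (X (v, f v) : MvPolynomial (α × β) ℝ≥0) =
      ∑ f ∈ S, monomial (gexp f) (1 : ℝ≥0) := by
    refine Finset.sum_congr rfl fun f _ => ?_
    rw [gexp, monomial_sum_one]
    rfl
  have hcoeff : ∀ γ, coeff γ (∑ f ∈ S, ∏ v : α, (X (v, f v) : MvPolynomial (α × β) ℝ≥0)) =
      ∑ f ∈ S, if gexp f = γ then (1 : ℝ≥0) else 0 := by
    intro γ; rw [hsum, coeff_sum]; simp only [coeff_monomial]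
  -- distinct members have distinct exponents
  have hinj : ∀ f ∈ S, ∀ g ∈ S, gexp f = gexp g → f = g := by
    intro f hf g hg hfg
    by_contra hne
    obtain ⟨u, v, huv, hu, hv⟩ := hS f hf g hg hne
    exact gexp_ne_of_two_diff huv hu hv (Or.inl rfl) (by rw [add_zero, add_zero, hfg])
  have hpos : ∀ f ∈ S,
      coeff (gexp f) (∑ f ∈ S, ∏ v : α, (X (v, f v) : MvPolynomial (α × β) ℝ≥0)) ≠ 0 := by
    intro f hf
    rw [hcoeff]
    have := Finset.single_le_sum (f := fun g : α → β => if gexp g = gexp f then (1 : ℝ≥0) else 0)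
      (fun _ _ => zero_le) hf
    simp only [if_true] at this
    exact ne_of_gt (lt_of_lt_of_le one_pos this)
  have hsupp : ∀ γ, coeff γ (∑ f ∈ S, ∏ v : α, (X (v, f v) : MvPolynomial (α × β) ℝ≥0)) ≠ 0 →
      ∃ f ∈ S, gexp f = γ := by
    intro γ hγ
    rw [hcoeff] at hγ
    obtain ⟨f, hf, hne⟩ := Finset.exists_ne_zero_of_sum_ne_zero hγ
    refine ⟨f, hf, ?_⟩
    by_contra h
    exact hne (if_neg h)
  obtain ⟨f, hf, g, hg, hfg⟩ := h2
  refine not_posProj_stPoly_of_isolated ⟨gexp f, gexp g, fun h => hfg (hinj f hf g hg h),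
    hpos f hf, hpos g hg⟩ ?_
  intro α' β' hα' hβ' p q hq hpq
  obtain ⟨f', hf', rfl⟩ := hsupp α' hα'
  obtain ⟨g', hg', rfl⟩ := hsupp β' hβ'
  by_cases hfg' : f' = g'
  · rw [hfg']
  · obtain ⟨u, v, huv, hu, hv⟩ := hS f' hf' g' hg' hfg'
    exact (gexp_ne_of_two_diff huv hu hv hq hpq).elim

/-- Distinct fixed-point-free involutions (perfect matchings as maps) differ at two distinct
points. [folklore] -/
theorem two_diff_of_involutive {α : Type*} {f g : α → α} (hf : ∀ v, f (f v) = v ∧ f v ≠ v)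
    (hg : ∀ v, g (g v) = v ∧ g v ≠ v) (hne : f ≠ g) :
    ∃ u v, u ≠ v ∧ f u ≠ g u ∧ f v ≠ g v := by
  obtain ⟨u, hu⟩ : ∃ u, f u ≠ g u := by
    by_contra h
    push Not at h
    exact hne (funext h)
  refine ⟨u, f u, (hf u).2.symm, hu, ?_⟩
  rw [(hf u).1]
  intro h
  -- `g (f u) = u` forces `g u = f u`
  have := (hg (f u)).1
  rw [← h] at this
  exact hu this.symm

/-- **Dimer polynomials are not positive `ST`-projections**: for every finite family `S` of
fixed-point-free involutions (dimer covers in the crux encoding `Σ_f Π_v x_{(v, f v)}`) with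
two distinct members, the graph sum is not a positive projection of any `ST_N`. [folklore] -/
theorem not_posProj_stPoly_dimerSum {α : Type*} [Fintype α] [DecidableEq α]
    (S : Finset (α → α)) (hinv : ∀ f ∈ S, ∀ v, f (f v) = v ∧ f v ≠ v)
    (h2 : ∃ f ∈ S, ∃ g ∈ S, f ≠ g) :
    ¬ ∃ (N : ℕ) (e : Fin N × Option (Fin N) → MvPolynomial (α × α) ℝ≥0),
      (∀ v, (∃ j, e v = X j) ∨ ∃ r, e v = C r) ∧
      aeval e (stPoly ℝ≥0 N) = ∑ f ∈ S, ∏ v : α, (X (v, f v) : MvPolynomial (α × α) ℝ≥0) :=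
  not_posProj_stPoly_graphSum S h2 fun f hf g hg hfg =>
    two_diff_of_involutive (hinv f hf) (hinv g hg) hfg

end Isolated

/-! ### Sums of spanning-tree polynomials in disjoint variables -/

section SumST

/-- A monomial of `rename f (ST_a)` is the image of an arborescence monomial. [folklore] -/
theorem exists_arb_of_coeff_rename_stPoly {a : ℕ} {τ : Type*} (f : Fin a × Option (Fin a) → τ)
    {γ : τ →₀ ℕ} (h : coeff γ (rename f (stPoly ℝ≥0 a)) ≠ 0) :
    ∃ t : Fin a → Option (Fin a), IsArborescence t ∧ Finsupp.mapDomain f (arbMonomial t) = γ := by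
  classical
  obtain ⟨u, hu, hcu⟩ := coeff_rename_ne_zero f _ γ h
  rw [coeff_stPoly] at hcu
  split_ifs at hcu with ht
  · obtain ⟨t, ht', htu⟩ := Finset.mem_image.mp ht
    exact ⟨t, mem_arborescences.mp ht', htu ▸ hu⟩
  · exact absurd rfl hcu

/-- The core step: an `inr`-supported exponent is never one label away from the `inl`-image of
an arborescence monomial on `a ≥ 2` nodes (two of its unit entries would have to be paid by the
single label `p`). [folklore] -/
theorem mapDomain_inr_add_label_ne {a b : ℕ} (ha : 2 ≤ a) (t : Fin a → Option (Fin a))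
    (u : (Fin b × Option (Fin b)) →₀ ℕ)
    {p q : ((Fin a × Option (Fin a)) ⊕ (Fin b × Option (Fin b))) →₀ ℕ}
    (hp : p = 0 ∨ ∃ j, p = Finsupp.single j 1)
    (h : Finsupp.mapDomain Sum.inr u + p = Finsupp.mapDomain Sum.inl (arbMonomial t) + q) :
    False := by
  classical
  set i₀ : Fin a := ⟨0, by omega⟩
  set i₁ : Fin a := ⟨1, by omega⟩
  have h01 : i₀ ≠ i₁ := by intro h; have := congrArg Fin.val h; simp [i₀, i₁] at this
  have key : ∀ i : Fin a, 1 ≤ p (Sum.inl (i, t i)) := by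
    intro i
    have := congrArg (fun f => f (Sum.inl (i, t i))) h
    simp only [Finsupp.add_apply] at this
    rw [Finsupp.mapDomain_notin_range _ _ (by rintro ⟨x, hx⟩; cases hx),
      Finsupp.mapDomain_apply Sum.inl_injective, arbMonomial_apply, if_pos rfl] at this
    omega
  rcases hp with rfl | ⟨j, rfl⟩
  · have := key i₀; simp at this
  · have h0 := key i₀
    have h1 := key i₁
    rw [Finsupp.single_apply] at h0 h1
    split_ifs at h0 with hj0
    · split_ifs at h1 with hj1
      · rw [hj0] at hj1
        simp only [Sum.inl.injEq, Prod.mk.injEq] at hj1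
        exact h01 hj1.1
      · omega
    · omega

/-- **`ST_a(x) + ST_b(y)` is not a positive projection of any `ST_N`** (`a ≥ 2`, `b ≥ 1`,
disjoint variable sets): its support splits into the `x`-monomials and the `y`-monomials with no
one-label bridge.  So single positive `ST`-quotients are not closed under sums — the rigid
`J = 1` form `StQuotientComplete` of card arborescence-span needs `J ≥ 2` already here (as its
author anticipated), while sums ARE handled by the `J`-term span. [folklore] -/
theorem not_posProj_stPoly_sum {a b : ℕ} (ha : 2 ≤ a) (hb : 1 ≤ b) :
    ¬ ∃ (N : ℕ) (e : Fin N × Option (Fin N) →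
        MvPolynomial ((Fin a × Option (Fin a)) ⊕ (Fin b × Option (Fin b))) ℝ≥0),
      (∀ v, (∃ j, e v = X j) ∨ ∃ r, e v = C r) ∧
      aeval e (stPoly ℝ≥0 N) =
        rename Sum.inl (stPoly ℝ≥0 a) + rename Sum.inr (stPoly ℝ≥0 b) := by
  classical
  set P : MvPolynomial ((Fin a × Option (Fin a)) ⊕ (Fin b × Option (Fin b))) ℝ≥0 :=
    rename Sum.inl (stPoly ℝ≥0 a) + rename Sum.inr (stPoly ℝ≥0 b) with hP
  -- the class of `x`-supported exponents
  let U : (((Fin a × Option (Fin a)) ⊕ (Fin b × Option (Fin b))) →₀ ℕ) → Prop :=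
    fun γ => ∀ w, γ (Sum.inr w) = 0
  -- no `inr`-monomial maps onto an `inl`-image and conversely
  have hlr : ∀ (u : (Fin b × Option (Fin b)) →₀ ℕ) (t : Fin a → Option (Fin a)),
      Finsupp.mapDomain Sum.inr u ≠ Finsupp.mapDomain Sum.inl (arbMonomial t) := by
    intro u t h
    have := congrArg (fun f => f (Sum.inl ((⟨0, by omega⟩ : Fin a), t ⟨0, by omega⟩))) h
    simp only at this
    rw [Finsupp.mapDomain_notin_range _ _ (by rintro ⟨x, hx⟩; cases hx),
      Finsupp.mapDomain_apply Sum.inl_injective, arbMonomial_apply, if_pos rfl] at this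
    exact absurd this (by norm_num)
  have hrl : ∀ (u : (Fin a × Option (Fin a)) →₀ ℕ) (t : Fin b → Option (Fin b)),
      Finsupp.mapDomain Sum.inl u ≠ Finsupp.mapDomain Sum.inr (arbMonomial t) := by
    intro u t h
    have := congrArg (fun f => f (Sum.inr ((⟨0, by omega⟩ : Fin b), t ⟨0, by omega⟩))) h
    simp only at this
    rw [Finsupp.mapDomain_notin_range _ _ (by rintro ⟨x, hx⟩; cases hx),
      Finsupp.mapDomain_apply Sum.inr_injective, arbMonomial_apply, if_pos rfl] at this
    exact absurd this (by norm_num)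
  have hstar : ∀ c : ℕ, IsArborescence (fun _ : Fin c => (none : Option (Fin c))) :=
    fun c => isArborescence_star
  refine not_posProj_stPoly_of_split U ?_ ?_ ?_
  · -- an `x`-monomial: the star of `ST_a`
    refine ⟨Finsupp.mapDomain Sum.inl (arbMonomial fun _ : Fin a => (none : Option (Fin a))),
      ?_, ?_⟩
    · rw [hP, coeff_add, coeff_rename_mapDomain _ Sum.inl_injective, coeff_stPoly,
        if_pos (Finset.mem_image.mpr ⟨_, mem_arborescences.mpr (hstar a), rfl⟩),
        coeff_rename_eq_zero]
      · norm_num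
      · intro u hu; exact absurd hu (hlr u _)
    · intro w
      exact Finsupp.mapDomain_notin_range _ _ (by rintro ⟨x, hx⟩; cases hx)
  · -- a `y`-monomial: the star of `ST_b`
    refine ⟨Finsupp.mapDomain Sum.inr (arbMonomial fun _ : Fin b => (none : Option (Fin b))),
      ?_, ?_⟩
    · rw [hP, coeff_add, coeff_rename_mapDomain _ Sum.inr_injective, coeff_stPoly,
        if_pos (Finset.mem_image.mpr ⟨_, mem_arborescences.mpr (hstar b), rfl⟩),
        coeff_rename_eq_zero]
      · norm_num
      · intro u hu; exact absurd hu (hrl u _)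
    · intro hU
      have := hU ((⟨0, by omega⟩ : Fin b), none)
      rw [Finsupp.mapDomain_apply Sum.inr_injective, arbMonomial_apply, if_pos rfl] at this
      exact one_ne_zero this
  · -- separation
    intro α β hα hβ hUα p q hp _ h
    by_contra hUβ
    -- `β` is a `y`-monomial
    have hβ' : coeff β (rename Sum.inr (stPoly ℝ≥0 b)) ≠ 0 := by
      intro h0
      rw [hP, coeff_add, h0, add_zero] at hβ
      obtain ⟨t, _, rfl⟩ := exists_arb_of_coeff_rename_stPoly _ hβ
      exact hUβ fun w => Finsupp.mapDomain_notin_range _ _ (by rintro ⟨x, hx⟩; cases hx)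
    obtain ⟨tb, _, rfl⟩ := exists_arb_of_coeff_rename_stPoly _ hβ'
    -- `α` is an `x`-monomial
    have hα' : coeff α (rename Sum.inl (stPoly ℝ≥0 a)) ≠ 0 := by
      intro h0
      rw [hP, coeff_add, h0, zero_add] at hα
      obtain ⟨t, _, rfl⟩ := exists_arb_of_coeff_rename_stPoly _ hα
      have := hUα ((⟨0, by omega⟩ : Fin b), t ⟨0, by omega⟩)
      rw [Finsupp.mapDomain_apply Sum.inr_injective, arbMonomial_apply, if_pos rfl] at this
      exact one_ne_zero this
    obtain ⟨ta, _, rfl⟩ := exists_arb_of_coeff_rename_stPoly _ hα'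
    exact mapDomain_inr_add_label_ne ha ta (arbMonomial tb) hp h

end SumST


end ExchangeG

/-! ### Why the crux resists (analysis, no new axioms) -/

/-- **Why `ZeroOneTransfer` resists refutation (and proof).**  Recorded facts, with sources:

1. *No tool.*  "Super-polynomial lower bounds on monotone circuits with division computing a
   monotone polynomial `f` are not known" (HrubesYehudayoff2021 §6, Problem 2 / Open Problem 3;
   partial results only for `h` a monomial — JuknaSeiwertSergeev2022 Thm 1, HY21 Prop 43(3) —,
   `h` of small degree — HY21 Prop 43(2) —, and monotone FORMULAS via shadows — HY21 Thm 42/44).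
   An unconditional `¬ ZeroOneTransfer` = such a bound for an explicit 0/1 family that is moreover
   in `VP_ℂ`; the planner's own kill criterion (crux `TriangularDimersDivisionEasy`, Valiant's
   planar Pfaffian family) is exactly FominGrigorievKoshevoy2014 Remark 1.5, open since 2014.
   Literature re-checked 2026-08-16 (openalex/arxiv/crossref/galaxy: "monotone circuits with
   division", "subtraction-free complexity", Jukna–Seiwert tropical series, Jukna 2023 book):
   nothing newer.
2. *All reductions available are too weak for `VP` families.*  (i) Boolean: on `x ∈ {0,1}^m`,
   `[f h > 0] = [f > 0] ∧ [h > 0]`, so a size-`s` monotone circuit for `f h` plus one for `h` give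
   monotone Boolean circuits of size `O(s)` for `[f>0] ∧ ψ` and `ψ := [h>0]`; this dies at
   `h = Π x_i` (`ψ` = AND of everything) and gives at best `n^{Ω(log n)}` (Razborov) even for
   `per`.  Sharper: for multilinear homogeneous `f` at the ONE cofactor `h = (Σ_i x_i)^D` the support
   of `f h` is `{m : |m| = deg f + D, supp m ⊇ supp α for some α ∈ supp f}`, i.e. it remembers
   only the monotone Boolean function `[f > 0]`, and the balanced-product cover bound degenerates (the
   single product `(f·ℓ^{D₁})·ℓ^{D₂}` covers everything); for `f = per` that Boolean function is
   `PM_n` (monotone complexity open between `n^{Ω(log n)}` and `2^{O(n)}` since 1985), for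
   `f = D_n` (crux 4) it is perfect-matching existence in subgraphs of the triangular rhombus, for
   which no super-polynomial monotone Boolean bound is in print.  So at this single cofactor both
   H1 and a crux-4 kill of H2 already need a COEFFICIENT-sensitive monotone lower bound — none
   exists for circuits (the ε-sensitive bounds of CDGM2022 are coefficient-sensitive but for
   `F ∓ ε ST`, additive not multiplicative perturbations).  (ii) Tropical (remark; the polytope form is HY21 Lemma 12 in disguise): a monotone circuit
   over `ℝ≥0` tropicalises gate by gate (`supp(p+q) = supp p ∪ supp q`, `supp(pq) = supp p +
   supp q`, no cancellation), so `trop p (w) := min_{α ∈ supp p} ⟨α, w⟩` satisfies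
   `trop(f h) = trop f + trop h` and `trop f = trop(fh) − trop h` is a difference of two `(min,+)`
   circuits of sizes `≤ L₊(fh)`, `≤ L₊(h)` — ONE subtraction, at the output; equivalently
   `Newt f + P_h = P_{fh}` exhibits `Newt f` as a Minkowski summand, with constructible co-summand,
   of a polytope built by `≤ divComplexity f` Minkowski sums / hulls of unions.  Consequences: a
   kill needs either (a) a polytope invariant monotone under passing to a Minkowski summand and
   small on such circuit-polytopes — vertex and facet counts are not small (cube), 2-D shadow counts
   are small only for formulas (HY21 Thm 1/42) —, or (b) coefficient information, which the
   tropical/polytope shadow discards.  Division-easiness also forces small `(min,+,−)` circuits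
   (ReLU networks) for "minimum-weight monomial"; for every catalogued 0/1 `VP_ℂ` family that
   optimisation problem is in P (assignment, min-cost arborescence, planar min-weight perfect
   matching, min-cost flow for LGV families) and no super-polynomial ReLU-size lower bound for an
   explicit piecewise-linear function is known — consistent with the crux, no kill.
   (iv) Shadows / transparency (HY21 Thm 42, Prop 43, Rem 45–46, read 2026-08-16 from the CCC
   version p. 9:17–9:18): `σ(Newt(fh)) ≥ σ(Newt f)` bounds monotone FORMULAS for `fh` by
   `σ(Newt f)`, and via Hyafil circuits of size `s` and degree `d` by `2^{O(log s·log d)}`; so a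
   quasi-polynomial division certificate for `f` must have cofactor degree `≥ 2^{(log n)^{ω(1)}}`
   UNLESS `σ(Newt f_n)` is quasi-polynomial — but repeated squaring makes such degrees cost only
   polylog-many gates, and for 0/1 `VP` families no super-quasi-polynomial shadow complexity is
   even known (`σ(CONN_n) = 2^{Θ(log² n)}` for IMM, HY21 Prop 22 / Rem 25; `σ(DS_n)`, `σ(MATCH_n)`
   open, HY21 Open Problem 1).  HY21's own words (p. 9:17): "Super-polynomial lower bounds on
   monotone circuits with division computing a monotone polynomial f are not known."  Their
   transparent 0/1 polynomial `Art_n` (Cor. 40, `2^n` monomials on `3n` variables, graph of binary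
   squaring) would kill the crux up to cofactor degree `2^{o(√n)}` (Prop 43(2)) IF it were in
   `VP` — not claimed there and not expected (it is a constraint-network partition function of a
   squaring circuit, `VNP` by Valiant's criterion).  (iii) Degenerations: `divComplexity` is monotone under `x_i := c ≥ 0`,
   `x_i := x_j` and under initial forms `in_w` (no cancellation over `ℝ≥0`, and `h ≠ 0 ⇒
   h(…, c, …) ≠ 0`, `in_w h ≠ 0`), so a kill may first degenerate the `VP` family; but every
   degeneration target with a KNOWN division lower bound is missing (item 1).
3. *Internal tension of the route (for the planner).*  The only proof technology for H1
   (`PerDivisionHard`) on offer — parse-tree covers / content bounds made robust to the Minkowski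
   summand `supp h` — is insensitive to the difference between `per_n` (all perfect matchings of
   `K_{n,n}`) and Valiant's planar matching family `D_n` (Valiant1980 Thm 1 is the same cover
   argument); a cover-type proof of H1 robust to `h` would most likely prove
   `¬ TriangularDimersDivisionEasy` verbatim and thus `¬ ZeroOneTransfer`.  H1 ∧ H2 needs an H1
   proof using a property of `per` that planar Pfaffian families lack.
5. *Faces and border complexity (cycle 2).*  By (D) the crux forces EVERY face polynomial
   `in_w(f_n)` of every 0/1 `VP` family to be qp-division-easy, hence (Strassen's division
   elimination at output degree `≤ deg f_n`, cost `O(d²)` per gate independently of `deg g`,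
   `deg h`) to lie in `VQP`.  But `in_w f = lim_{t→∞} t^{-D} f(t^{w} x)` is a border limit of
   the same circuit, so faces of `VP` families lie in `VP‾` anyway; a `VNP`-hard face (the
   card free-degeneration's proposed falsifier: homomorphism polynomials cut to injective
   supports) would prove `VNP ⊆ VP‾` — not believed (Mulmuley–Sohoni).  So the face criterion
   can only bite through a face with a DIRECT `{+,×,÷}` lower bound (none known, item 1), or
   inside the route: `not_perDivisionHard_and_zeroOneTransfer_of_perFace` (H1 ∧ H2 ⇒ per is not
   a face of 0/1-`VP`).  Faces of the catalogued 0/1 `VP` families stay in tractable classes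
   (planar dimers ↦ sub-graphs; lattice LGV paths ↦ planar split graphs, Kasteleyn; arborescences
   ↦ laminar-tight arborescences, countable by the exit-node recursion) — no candidate.
6. *Multiplicative cofactors `F^k` (cycle 2).*  The rows machinery (B2)/(E) excludes every
   cofactor whose row-lex initial form misses `≥ 60 + O((log N)^c)` rows; the first cofactors it
   cannot touch are row-homogeneous on all rows, e.g. `F^k = (Π_i Σ_j x_ij)^k`, `f^k`, products of
   pivots.  For `per` (H1): `[per·F^k > 0] = PM_n` on `{0,1}^{n×n}`, so `L₊(per_n · F^k) ≥`
   monotone Boolean complexity of bipartite perfect matching `= n^{Ω(log n)}` (Razborov 1985),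
   and a quasi-polynomial UPPER bound for some `k` would give PM ∈ mqP-size monotone circuits,
   open since 1985 in the other direction too (best upper bound `2^{O(n)}`) — so neither H1's
   first open rung nor its refutation is cheap.  Coefficients of `per·F`: `coeff_α = per(A_α)`
   for the row-2-sparse matrix `A_α`, individually easy.
7. *Polytopes (cycle 2).*  HertrichLoho2024 (arXiv:2411.03006): `divC(f) ≳ vxc(Newt f) :=
   min{xc Q + xc R : Newt f + Q = R}` (Newton polytopes of size-`s` monotone circuits have
   extension complexity `O(s)`: `Newt(p+q) = conv(P ∪ Q)`, `Newt(pq) = P + Q`), and lower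
   bounds on `vxc` are an OPEN PROBLEM (ibid. p.4); moreover the natural 0/1 `VP` families have
   `xc(Newt f_n) = poly` (planar perfect matching polytopes: Barahona; arborescence and regular
   matroid base polytopes: flows / Hertrich et al. 2026), so even `xc` gives nothing there.
4. *What is settled here.*  (A) without `VP` the statement is false (degree blow-up);
   (B) without division it is false (`ST`, this file, from tree facts); the 0/1 clause could not
   be attacked: no nonnegative-coefficient `VP` family with a super-polynomial `{+,×,÷}` bound is
   known either (FGK14 §8's exponential `{+,×,÷}` bounds are for NON-monotone targets), so
   `ZeroOneTransferWithout01` (nonnegative coefficients) is open, not refuted; (D)/(E) cycle 2: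
   faces and positive specialisations inherit division-easiness, Pólya multipliers and
   few-rows cofactors are refuted as certificate classes. [folklore] -/
theorem resists : ZeroOneTransferNoDivision → ZeroOneTransfer := zeroOneTransfer_of_noDivision

end Summit.ValiantsHypothesis.ValiantsHypothesis.Cruxes.ZeroOneTransfer.Disproof

end
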